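import Literature.NumberTheory.Transcendental.PkappaThetaLaws
import Literature.NumberTheory.Transcendental.PkappaThetaChartIdentities
import Literature.NumberTheory.Transcendental.PkappaThetaBlockRelations
import Literature.NumberTheory.EllipticCurves.ComplexTorus
import Literature.NumberTheory.EllipticCurves.RealLatticePeriodHalfPeriodsProofs
import Mathlib.Algebra.MvPolynomial.Supported
import Mathlib.RingTheory.MvPolynomial.EulerIdentity
import Mathlib.LinearAlgebra.Dual.Lemmas
import Mathlib.LinearAlgebra.FiniteDimensional.Lemmas
import HarnessLib

/-!
# The cone over the theta model of `M_κ`: Zariski tangent spaces, the Jacobian criterion, boundary forms and the image theorem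

Topic: `Literature/NumberTheory/Transcendental`. A brick of the programme towards the named fact
`Literature.NumberTheory.Transcendental.philippon1986_std` (Philippon's zero estimate for the
groups `M_κ = 𝔾ₘ^β × P_κ` in the theta embedding `GaGmE.Std.theta`), supplying for the theta
model the field `locRel` (the JACOBIAN CRITERION at every point: `N - n` homogeneous relations with
linearly independent differentials) of an analytic group model (`ZeroEstModel.lean`,
`AnalyticGroupModel`), WITHOUT writing down relations at every point. We transport the Zariski
tangent space of the cone `C = ℂ·Θ(V) ⊆ ℂ^{N+1}` along the group by the polynomial addition
laws of `PkappaThetaLaws.lean`: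

* `GaGmE.Std.relSet` — the homogeneous relations `P` (`F_P = P(Θ) ≡ 0`); `GaGmE.Std.tangentAt a`
  — the Zariski tangent space `{v ; ∑_J ∂_JP(a) v_J = 0 ∀ P}` of the cone at `a`, invariant under
  `a ↦ c·a` (`tangentAt_smul`);
* **transport** (`finrank_tangentAt_theta_le`): `dim T(Θ(w)) ≤ dim T(Θ(w + v))` for ALL `w, v`.
  With a composite law `A = claw_s` good at `(w, v)` the polynomial map `F(x) = A(x, Θ(v))`
  satisfies `F(Θ(w')) = U_s(w', v) Θ(w' + v)`, pulls relations back to relations, hence maps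
  `T(Θ w)` to `T(F(Θ w)) = T(Θ(w+v))` by its formal differential (`pderiv_bind₁`, the formal
  chain rule); with `G(y) = A'(y, Θ(-v))` one has `G(F(Θ w')) = φ(w') Θ(w')` for all `w'`, so the
  `2 × 2` minors `(G∘F)_I X_K - (G∘F)_K X_I` are relations, and differentiating them shows that a
  tangent vector killed by `dF` is a multiple of `Θ(w)`, then zero by Euler's identity — provided
  `φ(w) ≠ 0`, which the COMPLETE system of laws grants;
* **one good point** (`finrank_tangentAt_refPt_le`): at `w₀` (all `E`-coordinates equal to a
  point `z₀` with `z₀, 2z₀ ∉ Λ`) the tangent space injects into the `n + 1` coordinates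
  `X_{J₀}, X_{(j,0)}, X_{(0,δ_b)}, X_{(0,e)}` (`J₀ = (none, (0, none))`): every other variable
  `X_J` is the leading variable of an explicit relation — Segre relations for the torus indices,
  block Segre relations, the Weierstrass cubic `X_{J₀}X_{(2δ_b)}² = 4X_{(δ_b)}³ - g₂X_{J₀}²X_{(δ_b)} - g₃X_{J₀}³`
  in each block, and the exchange relations of the fibre coordinates
  `X_{(M,e)}X_{J₀} - X_{(0,e)}X_{(M,∅)} + ∑_{M_b = 2} 2κ_{eb} X_{(M[b↦1],∅)}X_{(δ_b,∅)}` (from the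
  exact jet identities `Z₂P₀ - Z₀P₂ = 2P₁²`, `Z₁P₀ = Z₀P₁`) — triangular for a rank function;
* **the Jacobian criterion** (`theta_locRel`): at every `w`, `N - n` homogeneous relations with
  linearly independent gradients at `Θ(w)` (`dim span{∇P(Θ w)} ≥ (N+1) - dim T(Θ w)` by duality,
  then a basis extraction).

Second part (fields `bdry`, `isHomogeneous_bdry`, `exists_bdry_ne_zero`, `surj`): the
quasi-projective variety `G = Ḡ ∖ Z(bdry)` parametrised by `Θ` and the **image theorem** — every
point of the cone over the projective closure `Ḡ` (a common zero of all homogeneous relations of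
`Θ`) off the boundary is a point `c · Θ(w)`:

* `GaGmE.Std.bdryForm M = ∏_{a : Option β} X_{(a, (M a, none))}` — the **boundary forms**, one
  for each choice of block charts `M : Option β → (γ → Fin 3)` (forms of degree `|β| + 1`); at every
  `w` one of them is non-zero at `Θ(w)` (`exists_eval_bdryForm_ne_zero`). Their common zero set on
  `Ḡ` is the boundary: a torus coordinate `T_a = 0`, or the divisor at infinity of the fibres;
* `GaGmE.Std.theta_surj` — **the image theorem**: if `x ∈ ℂ^{N+1}` kills every homogeneous relation
  of `Θ` and some boundary form is non-zero at `x`, then `x = c · Θ(w)`. Reconstruction of `w`: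
  the Segre relations make `x` a rank-one tensor `t_a p_I`; the block swap relations make the
  block part a rank-one tensor `∏_b q_b(M_b)` relative to a chart `M0`; each block vector
  `q_b ∈ ℂ³ ∖ 0` lies on the cone over the Weierstrass cubic (`exists_univExtP_eq_smul`:
  `q_b = c_b · P(z_b)`, by `℘(ℂ ∖ Λ) = ℂ`, the parity of `℘′`, and `P(0) = (0, 0, -2)` over the flex
  at infinity); the torus part is `e^{y_j}` by logarithms; the fibre coordinates `s_e` are read
  off the chart ratio, and all other fibre coordinates are forced by the **exchange relations**
  `X_{(M,e)}X_{(M0,∅)} - X_{(M0,e)}X_{(M,∅)} + ∑_b κ_{eb} Q_b = 0` (`exchangeRel_mem_relSet`, from the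
  block identities `Z_iP_j - Z_jP_i` of `PkappaThetaBlockRelations.lean`).

Everything is PROVED; the only definitions are the relation set, the tangent space, the
polynomial maps of the laws, the reference point, the coordinate and rank functions, the
explicit relations, the boundary forms and the exchange coefficient table.

## References

* Yu. V. Nesterenko, P. Philippon (eds.), *Introduction to Algebraic Independence Theory*,
  LNM 1752, Springer 2001, Ch. 11 (D. Roy), §2.2 (i) (`G` non-singular), Prop. 2.2 (proof).
  [NesterenkoPhilippon2001]
* A. Baker, G. Wüstholz, *Logarithmic Forms and Diophantine Geometry*, CUP 2007, §6.9
  (projective embeddings of commutative group varieties). [BakerWustholz2007]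
* T. A. Springer, *Linear Algebraic Groups*, 2nd ed., Thm. 4.3.7 (homogeneous spaces are smooth).
  [SpringerLAG1998]
-/

noncomputable section

open Complex MvPolynomial Set Module
open scoped PeriodPair

namespace Literature.NumberTheory.Transcendental

/-! ### The formal chain rule -/

/-- **Formal chain rule**: `∂_i (P(f)) = ∑_j (∂_j P)(f) · ∂_i f_j`. [folklore] -/
theorem pderiv_bind₁ {σ τ R : Type*} [CommRing R] [Fintype σ] (f : σ → MvPolynomial τ R) (i : τ)
    (P : MvPolynomial σ R) :
    pderiv i (bind₁ f P) = ∑ j, bind₁ f (pderiv j P) * pderiv i (f j) := by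
  classical
  induction P using MvPolynomial.induction_on with
  | C a => simp
  | add p q hp hq => simp only [map_add, hp, hq, add_mul, Finset.sum_add_distrib]
  | mul_X p j hp =>
    have hsingle : ∀ k : σ, bind₁ f (Pi.single (M := fun _ => MvPolynomial σ R) k 1 j) =
        if j = k then 1 else 0 := by
      intro k
      by_cases h : j = k
      · subst h; simp
      · simp [h]
    have hR : ∀ k, bind₁ f (pderiv k (p * X j)) =
        bind₁ f (pderiv k p) * f j + bind₁ f p * (if j = k then 1 else 0) := by
      intro k
      rw [Derivation.leibniz, pderiv_X, smul_eq_mul, smul_eq_mul, map_add, map_mul, map_mul,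
        bind₁_X_right, hsingle k]
      ring
    rw [map_mul, bind₁_X_right, Derivation.leibniz, smul_eq_mul, smul_eq_mul, hp]
    simp_rw [hR, add_mul, Finset.sum_add_distrib]
    conv_lhs => rw [add_comm]
    congr 1
    · rw [Finset.mul_sum]
      exact Finset.sum_congr rfl fun k _ => by ring
    · simp [mul_ite, ite_mul, Finset.sum_ite_eq]

/-- **Evaluated chain rule**: `∂_i(P∘f)(a) = ∑_j (∂_jP)(f(a)) · (∂_i f_j)(a)`. [folklore] -/
theorem eval_pderiv_bind₁ {σ τ : Type*} [Fintype σ] (f : σ → MvPolynomial τ ℂ) (i : τ)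
    (P : MvPolynomial σ ℂ) (a : τ → ℂ) :
    eval a (pderiv i (bind₁ f P)) =
      ∑ j, eval (fun k => eval a (f k)) (pderiv j P) * eval a (pderiv i (f j)) := by
  rw [pderiv_bind₁, map_sum]
  exact Finset.sum_congr rfl fun j _ => by rw [map_mul, eval_bind₁]

/-- **Euler's identity, evaluated**: `∑_J a_J (∂_J P)(a) = d · P(a)` for a form of degree `d`.
[folklore] -/
theorem sum_mul_eval_pderiv_of_isHomogeneous {σ : Type*} [Fintype σ] {P : MvPolynomial σ ℂ} {d : ℕ}
    (hP : P.IsHomogeneous d) (a : σ → ℂ) :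
    ∑ J, a J * eval a (pderiv J P) = d * eval a P := by
  have h := congrArg (eval a) hP.sum_X_mul_pderiv
  simp only [map_sum, map_mul, eval_X, nsmul_eq_mul, map_natCast] at h
  simpa using h

namespace GaGmE

namespace Std

variable {β γ δ : Type} [Fintype β] [Fintype γ] [Fintype δ] [DecidableEq γ]
variable (L : PeriodPair) (κM : δ → γ → Kbar)

/-! ### Relations and Zariski tangent spaces of the theta cone -/

/-- **The homogeneous relations of the theta model**: forms `P` with `F_P = P(Θ) ≡ 0` on
`Lie M_κ,ℂ` (the homogeneous elements of Roy's `𝔊 = 𝔍(G)`). [cite: NesterenkoPhilippon2001, Ch. 11 §2.2] -/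
def relSet : Set (MvPolynomial (Option β × ThetaIdx γ δ) ℂ) :=
  {P | (∃ d, P.IsHomogeneous d) ∧ ∀ w, thetaEval L κM P w = 0}

omit [Fintype β] [Fintype δ] in
/-- Membership in `relSet`. [folklore] -/
theorem mem_relSet_iff {P : MvPolynomial (Option β × ThetaIdx γ δ) ℂ} :
    P ∈ relSet L κM ↔ (∃ d, P.IsHomogeneous d) ∧ ∀ w, thetaEval L κM P w = 0 := Iff.rfl

/-- **The gradient** `∇P(a) = ((∂_J P)(a))_J`. [folklore] -/
def grad (a : Option β × ThetaIdx γ δ → ℂ) (P : MvPolynomial (Option β × ThetaIdx γ δ) ℂ) :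
    Option β × ThetaIdx γ δ → ℂ :=
  fun J => eval a (pderiv J P)

omit [Fintype β] [Fintype γ] [Fintype δ] [DecidableEq γ] in
/-- Components of the gradient. [folklore] -/
@[simp] theorem grad_apply (a : Option β × ThetaIdx γ δ → ℂ) (P : MvPolynomial (Option β × ThetaIdx γ δ) ℂ)
    (J : Option β × ThetaIdx γ δ) : grad a P J = eval a (pderiv J P) := rfl

/-- **The Zariski tangent space of the theta cone at `a ∈ ℂ^{N+1}`**: the vectors `v` with
`∑_J (∂_J P)(a) v_J = 0` for every homogeneous relation `P`. [cite: NesterenkoPhilippon2001, Ch. 11 §2.2 (i)] -/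
def tangentAt (a : Option β × ThetaIdx γ δ → ℂ) : Submodule ℂ (Option β × ThetaIdx γ δ → ℂ) where
  carrier := {v | ∀ P ∈ relSet L κM, ∑ J, grad a P J * v J = 0}
  zero_mem' := fun P _ => by simp
  add_mem' := by
    intro v v' hv hv' P hP
    simp only [Pi.add_apply, mul_add, Finset.sum_add_distrib, hv P hP, hv' P hP, add_zero]
  smul_mem' := by
    intro c v hv P hP
    simp only [Pi.smul_apply, smul_eq_mul, mul_left_comm _ c, ← Finset.mul_sum, hv P hP, mul_zero]

/-- Membership in the tangent space. [folklore] -/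
theorem mem_tangentAt_iff {a v : Option β × ThetaIdx γ δ → ℂ} :
    v ∈ tangentAt L κM a ↔ ∀ P ∈ relSet L κM, ∑ J, grad a P J * v J = 0 := Iff.rfl

omit [Fintype β] [Fintype γ] [Fintype δ] [DecidableEq γ] in
/-- **Gradients of forms scale**: `∇P(c·a) = c^{d-1} ∇P(a)` for a form of degree `d`. [folklore] -/
theorem grad_smul {P : MvPolynomial (Option β × ThetaIdx γ δ) ℂ} {d : ℕ} (hP : P.IsHomogeneous d)
    (c : ℂ) (a : Option β × ThetaIdx γ δ → ℂ) : grad (c • a) P = c ^ (d - 1) • grad a P := by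
  funext J
  simp only [grad_apply, Pi.smul_apply, smul_eq_mul]
  exact eval_smul_of_isHomogeneous hP.pderiv c a

/-- **The tangent space of the cone is constant along rays**: `T(c·a) = T(a)` for `c ≠ 0`.
[folklore] -/
theorem tangentAt_smul {c : ℂ} (hc : c ≠ 0) (a : Option β × ThetaIdx γ δ → ℂ) :
    tangentAt L κM (c • a) = tangentAt L κM a := by
  ext v
  simp only [mem_tangentAt_iff]
  refine forall₂_congr fun P hP => ?_
  obtain ⟨⟨d, hd⟩, -⟩ := hP
  simp only [grad_smul hd, Pi.smul_apply, smul_eq_mul, mul_assoc, ← Finset.mul_sum,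
    mul_eq_zero, pow_eq_zero_iff', hc, ne_eq, false_and, false_or]

/-! ### From a bound on the tangent space to independent relations -/

/-- **Duality count**: the span of the gradients of the relations at `a` has dimension at least
`(N + 1) - dim T(a)`. [folklore] -/
theorem card_le_finrank_span_grad_add (a : Option β × ThetaIdx γ δ → ℂ) :
    Fintype.card (Option β × ThetaIdx γ δ) ≤
      finrank ℂ (Submodule.span ℂ (grad a '' relSet L κM)) + finrank ℂ (tangentAt L κM a) := by
  set Gr := Submodule.span ℂ (grad a '' relSet L κM) with hGr
  -- the pairing `v ↦ (g ↦ ∑ g_J v_J)` restricted to `Gr`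
  let B : (Option β × ThetaIdx γ δ → ℂ) →ₗ[ℂ] (Option β × ThetaIdx γ δ → ℂ) →ₗ[ℂ] ℂ :=
    LinearMap.mk₂ ℂ (fun v g => ∑ J, g J * v J)
      (fun v v' g => by simp only [Pi.add_apply, mul_add, Finset.sum_add_distrib])
      (fun c v g => by
        simp only [Pi.smul_apply, smul_eq_mul, Finset.mul_sum]
        exact Finset.sum_congr rfl fun J _ => by ring)
      (fun v g g' => by simp only [Pi.add_apply, add_mul, Finset.sum_add_distrib])
      (fun c v g => by
        simp only [Pi.smul_apply, smul_eq_mul, Finset.mul_sum]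
        exact Finset.sum_congr rfl fun J _ => by ring)
  let ψ : (Option β × ThetaIdx γ δ → ℂ) →ₗ[ℂ] Module.Dual ℂ Gr := (LinearMap.domRestrict' Gr).comp B
  have hker : LinearMap.ker ψ = tangentAt L κM a := by
    ext v
    simp only [LinearMap.mem_ker, mem_tangentAt_iff]
    constructor
    · intro h P hP
      have hg : grad a P ∈ Gr := Submodule.subset_span ⟨P, hP, rfl⟩
      have := LinearMap.congr_fun h ⟨grad a P, hg⟩
      simpa [ψ, B] using this
    · intro h
      apply LinearMap.ext
      rintro ⟨g, hg⟩
      simp only [ψ, B, LinearMap.coe_comp, Function.comp_apply, LinearMap.domRestrict'_apply,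
        LinearMap.mk₂_apply, LinearMap.zero_apply]
      -- `g ↦ ∑ g_J v_J` vanishes on the generators, hence on the span
      have hle : Gr ≤ LinearMap.ker (B v) := by
        rw [hGr, Submodule.span_le]
        rintro _ ⟨P, hP, rfl⟩
        simpa [B] using h P hP
      simpa [B] using hle hg
  have hrn := LinearMap.finrank_range_add_finrank_ker ψ
  rw [hker, Module.finrank_fintype_fun_eq_card] at hrn
  have hrange : finrank ℂ (LinearMap.range ψ) ≤ finrank ℂ Gr :=
    (Submodule.finrank_le _).trans (Subspace.dual_finrank_eq (K := ℂ) (V := Gr)).le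
  omega

/-- **Extraction of independent relations.** If `dim T(a) + m ≤ N + 1`, there are `m` relations
whose gradients at `a` are linearly independent. [folklore] -/
theorem exists_relations_of_finrank_tangentAt_le (a : Option β × ThetaIdx γ δ → ℂ) {m : ℕ}
    (h : finrank ℂ (tangentAt L κM a) + m ≤ Fintype.card (Option β × ThetaIdx γ δ)) :
    ∃ S : Finset (MvPolynomial (Option β × ThetaIdx γ δ) ℂ), (∀ P ∈ S, P ∈ relSet L κM) ∧
      S.card = m ∧ LinearIndependent ℂ fun P : S => grad a P.1 := by
  classical
  -- an independent spanning subfamily of the gradients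
  obtain ⟨κ, ι, hι, hspan, hli⟩ :=
    exists_linearIndependent' (K := ℂ) (fun P : relSet L κM => grad a P.1)
  haveI : Finite κ := hli.finite
  letI : Fintype κ := Fintype.ofFinite κ
  have hcard : m ≤ Fintype.card κ := by
    have h1 := card_le_finrank_span_grad_add L κM a
    have h2 : finrank ℂ (Submodule.span ℂ (grad a '' relSet L κM)) = Fintype.card κ := by
      rw [Set.image_eq_range, ← hspan]
      exact finrank_span_eq_card hli
    omega
  -- `m` of them
  let e : Fin m ↪ κ := (Fin.castLEEmb hcard).trans (Fintype.equivFin κ).symm.toEmbedding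
  let sel : Fin m → MvPolynomial (Option β × ThetaIdx γ δ) ℂ := fun i => (ι (e i)).1
  have hsel : Function.Injective sel := by
    intro i j hij
    exact e.injective (hι (Subtype.val_injective hij))
  refine ⟨Finset.univ.image sel, ?_, ?_, ?_⟩
  · intro P hP
    obtain ⟨i, -, rfl⟩ := Finset.mem_image.mp hP
    exact (ι (e i)).2
  · rw [Finset.card_image_of_injective _ hsel, Finset.card_univ, Fintype.card_fin]
  · -- the family over the image is the independent family `grad ∘ ι ∘ e` reindexed by a bijection
    have hli' : LinearIndependent ℂ fun i : Fin m => grad a (sel i) :=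
      (hli.comp e e.injective)
    let f : {P // P ∈ Finset.univ.image sel} → Fin m := fun P =>
      (Finset.mem_image.mp P.2).choose
    have hf : ∀ P : {P // P ∈ Finset.univ.image sel}, sel (f P) = P.1 := fun P =>
      (Finset.mem_image.mp P.2).choose_spec.2
    have hfinj : Function.Injective f := by
      intro P Q hPQ
      apply Subtype.ext
      rw [← hf P, ← hf Q, hPQ]
    have := hli'.comp f hfinj
    rwa [show ((fun i : Fin m => grad a (sel i)) ∘ f) =
        fun P : {P // P ∈ Finset.univ.image sel} => grad a P.1 from
      funext fun P => by simp only [Function.comp_apply, hf]] at this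

/-! ### The points `Θ(w)` of the cone -/

/-- The point `Θ(w) ∈ ℂ^{N+1}`. [folklore] -/
def thetaVec (w : β ⊕ (γ ⊕ δ) → ℂ) : Option β × ThetaIdx γ δ → ℂ := fun J => theta L κM J w

omit [Fintype β] [Fintype δ] in
/-- Components of `Θ(w)`. [folklore] -/
@[simp] theorem thetaVec_apply (w : β ⊕ (γ ⊕ δ) → ℂ) (J : Option β × ThetaIdx γ δ) :
    thetaVec L κM w J = theta L κM J w := rfl

omit [Fintype β] [Fintype δ] in
/-- `F_P(w) = P(Θ(w))`. [folklore] -/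
theorem thetaEval_eq_eval_thetaVec (P : MvPolynomial (Option β × ThetaIdx γ δ) ℂ) (w : β ⊕ (γ ⊕ δ) → ℂ) :
    thetaEval L κM P w = eval (thetaVec L κM w) P := rfl

omit [Fintype β] [Fintype δ] in
/-- `Θ(w) ≠ 0`. [folklore] -/
theorem thetaVec_ne_zero (w : β ⊕ (γ ⊕ δ) → ℂ) : thetaVec L κM w ≠ 0 := by
  obtain ⟨J, hJ⟩ := exists_theta_ne_zero L κM w
  exact fun h => hJ (by simpa using congr_fun h J)

omit [Fintype β] [Fintype δ] in
/-- `Θ_{(none, I)} = Θ^P_I` (the torus coordinate `T_none = 1`). [folklore] -/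
theorem theta_none_eq (I : ThetaIdx γ δ) (w : β ⊕ (γ ⊕ δ) → ℂ) :
    theta L κM (none, I) w = thetaP (β := β) L κM I w := by
  simp [theta]

/-! ### The polynomial self-maps of the cone given by the addition laws -/

/-- **`F_{s,v}`: the composite law specialised at `Θ(v)` in its second argument**,
`F_{s,v,I}(X) = A^{(s)}_I(X, Θ(v)) ∈ ℂ[X]₄`. [cite: NesterenkoPhilippon2001, Ch. 11 §2.1 (84)] -/
def clawAt (s v : β ⊕ (γ ⊕ δ) → ℂ) (I : Option β × ThetaIdx γ δ) :
    MvPolynomial (Option β × ThetaIdx γ δ) ℂ :=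
  bind₁ (Sum.elim X fun J => C (theta L κM J v)) (claw L κM s I)

omit [Fintype β] [Fintype δ] in
/-- Evaluation of `F_{s,v,I}`. [folklore] -/
theorem eval_clawAt (s v : β ⊕ (γ ⊕ δ) → ℂ) (I : Option β × ThetaIdx γ δ)
    (a : Option β × ThetaIdx γ δ → ℂ) :
    eval a (clawAt L κM s v I) = eval (Sum.elim a fun J => theta L κM J v) (claw L κM s I) := by
  rw [clawAt, eval_bind₁]
  have hfun : (fun i => eval a (Sum.elim X (fun J => C (theta L κM J v)) i)) =
      Sum.elim a fun J => theta L κM J v := by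
    funext K
    rcases K with K | K <;> simp
  rw [hfun]

omit [Fintype β] [Fintype δ] in
/-- **`F_{s,v}(Θ(w)) = U_s(w, v) Θ(w + v)`.** [cite: NesterenkoPhilippon2001, Ch. 11 §2.1 (84)] -/
theorem eval_clawAt_thetaVec (s v : β ⊕ (γ ⊕ δ) → ℂ) (I : Option β × ThetaIdx γ δ) (w : β ⊕ (γ ⊕ δ) → ℂ) :
    eval (thetaVec L κM w) (clawAt L κM s v I) =
      clawUnit (β := β) (δ := δ) L s w v * theta L κM I (w + v) := by
  rw [eval_clawAt]
  exact eval_claw L κM s I w v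

omit [Fintype β] [Fintype δ] in
/-- `F_{s,v,I}` is a form of degree `4`. [folklore] -/
theorem clawAt_isHomogeneous (s v : β ⊕ (γ ⊕ δ) → ℂ) (I : Option β × ThetaIdx γ δ) :
    (clawAt L κM s v I).IsHomogeneous 4 := by
  classical
  rw [clawAt, ← aeval_eq_bind₁, MvPolynomial.aeval_def, MvPolynomial.eval₂_eq]
  refine IsHomogeneous.sum _ _ _ fun m hm => ?_
  set wt : (Option β × ThetaIdx γ δ) ⊕ (Option β × ThetaIdx γ δ) → ℕ :=
    Sum.elim (fun _ => 1) (fun _ => 0) with hwt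
  have hdeg : ∑ i ∈ m.support, wt i * m i = 4 := by
    have h := claw_isWeightedHomogeneous L κM s I (mem_support_iff.mp hm)
    rw [Finsupp.weight_apply, Finsupp.sum] at h
    rw [← h]
    exact Finset.sum_congr rfl fun i _ => by rw [smul_eq_mul, mul_comm]
  have hfac : ∀ i, ((Sum.elim X fun J => C (theta L κM J v)) i ^ m i :
      MvPolynomial (Option β × ThetaIdx γ δ) ℂ).IsHomogeneous (wt i * m i) := by
    rintro (J | J)
    · simpa [hwt] using isHomogeneous_X_pow (R := ℂ) (σ := Option β × ThetaIdx γ δ) J (m (Sum.inl J))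
    · simpa [hwt] using (isHomogeneous_C (Option β × ThetaIdx γ δ) (theta L κM J v)).pow (m (Sum.inr J))
  have hprod := IsHomogeneous.prod m.support
    (fun i => ((Sum.elim X fun J => C (theta L κM J v)) i ^ m i : MvPolynomial (Option β × ThetaIdx γ δ) ℂ))
    (fun i => wt i * m i) fun i _ => hfac i
  rw [← zero_add 4]
  exact (isHomogeneous_C _ _).mul (hdeg ▸ hprod)

omit [Fintype β] [Fintype δ] in
/-- **Relations pull back to relations** under `F_{s,v}`: `P ∈ relSet ⇒ P(F_{s,v}) ∈ relSet`.
[folklore] -/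
theorem bind₁_clawAt_mem_relSet {P : MvPolynomial (Option β × ThetaIdx γ δ) ℂ} (hP : P ∈ relSet L κM)
    (s v : β ⊕ (γ ⊕ δ) → ℂ) : bind₁ (clawAt L κM s v) P ∈ relSet L κM := by
  obtain ⟨⟨d, hd⟩, hP0⟩ := hP
  refine ⟨⟨4 * d, ?_⟩, fun w => ?_⟩
  · rw [← aeval_eq_bind₁]
    exact hd.aeval _ fun I => clawAt_isHomogeneous L κM s v I
  · rw [thetaEval_eq_eval_thetaVec, eval_bind₁]
    have hfun : (fun I => eval (thetaVec L κM w) (clawAt L κM s v I)) =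
        clawUnit (β := β) (δ := δ) L s w v • thetaVec L κM (w + v) := by
      funext I
      rw [eval_clawAt_thetaVec]
      rfl
    rw [hfun, eval_smul_of_isHomogeneous hd, ← thetaEval_eq_eval_thetaVec, hP0, mul_zero]

/-- **The formal differential `dF_{s,v}(a)`** of the polynomial map at `a`. [folklore] -/
def dClawAt (s v : β ⊕ (γ ⊕ δ) → ℂ) (a : Option β × ThetaIdx γ δ → ℂ) :
    (Option β × ThetaIdx γ δ → ℂ) →ₗ[ℂ] (Option β × ThetaIdx γ δ → ℂ) where
  toFun x := fun I => ∑ J, eval a (pderiv J (clawAt L κM s v I)) * x J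
  map_add' x y := by
    funext I
    simp only [Pi.add_apply, mul_add, Finset.sum_add_distrib]
  map_smul' c x := by
    funext I
    simp only [Pi.smul_apply, smul_eq_mul, RingHom.id_apply, Finset.mul_sum]
    exact Finset.sum_congr rfl fun J _ => by ring

/-- Components of `dF(a) x`. [folklore] -/
theorem dClawAt_apply (s v : β ⊕ (γ ⊕ δ) → ℂ) (a x : Option β × ThetaIdx γ δ → ℂ) (I : Option β × ThetaIdx γ δ) :
    dClawAt L κM s v a x I = ∑ J, eval a (pderiv J (clawAt L κM s v I)) * x J := rfl

/-- **`dF` maps the tangent space at `a` into the tangent space at `F(a)`** (chain rule and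
pull-back of relations). [folklore] -/
theorem dClawAt_mem_tangentAt (s v : β ⊕ (γ ⊕ δ) → ℂ) {a x : Option β × ThetaIdx γ δ → ℂ}
    (hx : x ∈ tangentAt L κM a) :
    dClawAt L κM s v a x ∈ tangentAt L κM fun I => eval a (clawAt L κM s v I) := by
  intro P hP
  have h := hx _ (bind₁_clawAt_mem_relSet L κM hP s v)
  simp only [grad_apply, eval_pderiv_bind₁, Finset.sum_mul] at h
  rw [Finset.sum_comm] at h
  rw [← h]
  refine Finset.sum_congr rfl fun I _ => ?_
  rw [grad_apply, dClawAt_apply, Finset.mul_sum]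
  exact Finset.sum_congr rfl fun J _ => by ring

/-! ### The composite `G ∘ F` and its minors -/

/-- **`(G ∘ F)_I`** for `F = F_{s,v}`, `G = F_{s',-v}`: a form of degree `16` with
`(G∘F)(Θ(w')) = φ(w') Θ(w')`. [folklore] -/
def clawGF (s s' v : β ⊕ (γ ⊕ δ) → ℂ) (I : Option β × ThetaIdx γ δ) :
    MvPolynomial (Option β × ThetaIdx γ δ) ℂ :=
  bind₁ (clawAt L κM s v) (clawAt L κM s' (-v) I)

/-- The scalar `φ(w') = U_s(w', v)⁴ U_{s'}(w' + v, -v)`. [folklore] -/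
def phiFun (s s' v w' : β ⊕ (γ ⊕ δ) → ℂ) : ℂ :=
  clawUnit (β := β) (δ := δ) L s w' v ^ 4 * clawUnit (β := β) (δ := δ) L s' (w' + v) (-v)

omit [Fintype β] [Fintype δ] in
/-- `(G∘F)_I` is a form of degree `16`. [folklore] -/
theorem clawGF_isHomogeneous (s s' v : β ⊕ (γ ⊕ δ) → ℂ) (I : Option β × ThetaIdx γ δ) :
    (clawGF L κM s s' v I).IsHomogeneous 16 := by
  have h := (clawAt_isHomogeneous L κM s' (-v) I).aeval _ fun K => clawAt_isHomogeneous L κM s v K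
  rw [aeval_eq_bind₁] at h
  simpa [clawGF] using h

omit [Fintype β] [Fintype δ] in
/-- **`(G∘F)(Θ(w')) = φ(w') Θ(w')`** for all `w'`. [folklore] -/
theorem eval_clawGF_thetaVec (s s' v : β ⊕ (γ ⊕ δ) → ℂ) (I : Option β × ThetaIdx γ δ) (w' : β ⊕ (γ ⊕ δ) → ℂ) :
    eval (thetaVec L κM w') (clawGF L κM s s' v I) = phiFun (β := β) (δ := δ) L s s' v w' * theta L κM I w' := by
  rw [clawGF, eval_bind₁]
  have hfun : (fun K => eval (thetaVec L κM w') (clawAt L κM s v K)) =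
      clawUnit (β := β) (δ := δ) L s w' v • thetaVec L κM (w' + v) := by
    funext K
    rw [eval_clawAt_thetaVec]
    rfl
  rw [hfun, eval_smul_of_isHomogeneous (clawAt_isHomogeneous L κM s' (-v) I), eval_clawAt_thetaVec,
    show w' + v + -v = w' by abel, phiFun]
  ring

/-- **The `2 × 2` minors** `(G∘F)_I X_K - (G∘F)_K X_I`. [folklore] -/
def minorRel (s s' v : β ⊕ (γ ⊕ δ) → ℂ) (I K : Option β × ThetaIdx γ δ) :
    MvPolynomial (Option β × ThetaIdx γ δ) ℂ :=
  clawGF L κM s s' v I * X K - clawGF L κM s s' v K * X I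

omit [Fintype β] [Fintype δ] in
/-- **The minors are relations** (`(G∘F)(Θ(w')) ∥ Θ(w')`). [folklore] -/
theorem minorRel_mem_relSet (s s' v : β ⊕ (γ ⊕ δ) → ℂ) (I K : Option β × ThetaIdx γ δ) :
    minorRel L κM s s' v I K ∈ relSet L κM := by
  refine ⟨⟨17, ?_⟩, fun w' => ?_⟩
  · exact ((clawGF_isHomogeneous L κM s s' v I).mul (isHomogeneous_X ℂ K)).sub
      ((clawGF_isHomogeneous L κM s s' v K).mul (isHomogeneous_X ℂ I))
  · rw [thetaEval_eq_eval_thetaVec]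
    simp only [minorRel, map_sub, map_mul, eval_X, eval_clawGF_thetaVec, thetaVec_apply]
    ring

/-! ### Injectivity of `dF` on the tangent space -/

open Classical in
omit [Fintype β] [Fintype δ] in
/-- The gradient of a minor, paired with a vector componentwise. [folklore] -/
theorem grad_minorRel_mul (s s' v : β ⊕ (γ ⊕ δ) → ℂ) (I K : Option β × ThetaIdx γ δ)
    (p x : Option β × ThetaIdx γ δ → ℂ) (J : Option β × ThetaIdx γ δ) :
    grad p (minorRel L κM s s' v I K) J * x J =
      eval p (pderiv J (clawGF L κM s s' v I)) * x J * p K +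
          eval p (clawGF L κM s s' v I) * (if K = J then x J else 0) -
        (eval p (pderiv J (clawGF L κM s s' v K)) * x J * p I +
          eval p (clawGF L κM s s' v K) * (if I = J then x J else 0)) := by
  classical
  have hδ : ∀ A : Option β × ThetaIdx γ δ,
      eval p (pderiv J (X A : MvPolynomial (Option β × ThetaIdx γ δ) ℂ)) = if A = J then 1 else 0 := by
    intro A
    rw [pderiv_X]
    by_cases h : A = J
    · subst h; simp
    · simp [h]
  rw [grad_apply, minorRel]
  simp only [map_sub, Derivation.leibniz, smul_eq_mul, map_add, map_mul, eval_X, hδ]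
  split_ifs <;> ring

/-- Gradient pairing of a minor with a vector `x`:
`∑_J ∂_J((GF)_I X_K - (GF)_K X_I)(p) x_J = (d(GF)x)_I p_K + (GF)_I(p) x_K - (d(GF)x)_K p_I - (GF)_K(p) x_I`.
[folklore] -/
theorem sum_grad_minorRel (s s' v : β ⊕ (γ ⊕ δ) → ℂ) (I K : Option β × ThetaIdx γ δ)
    (p x : Option β × ThetaIdx γ δ → ℂ) :
    ∑ J, grad p (minorRel L κM s s' v I K) J * x J =
      (∑ J, eval p (pderiv J (clawGF L κM s s' v I)) * x J) * p K + eval p (clawGF L κM s s' v I) * x K -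
        ((∑ J, eval p (pderiv J (clawGF L κM s s' v K)) * x J) * p I + eval p (clawGF L κM s s' v K) * x I) := by
  classical
  simp only [grad_minorRel_mul, Finset.sum_sub_distrib, Finset.sum_add_distrib, ← Finset.sum_mul,
    ← Finset.mul_sum, Finset.sum_ite_eq, Finset.mem_univ, if_true]

/-- **Injectivity of `dF` on the tangent space.** If `φ(w) ≠ 0`, a tangent vector `x` at
`p = Θ(w)` with `dF_{s,v}(p) x = 0` vanishes: `d(G∘F)(p) x = 0`, the minors give
`φ(w)(p_I x_K - p_K x_I) = 0`, so `x = t·p`, and Euler's identity `d(G∘F)(p) p = 16 φ(w) p` gives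
`t = 0`. [folklore] -/
theorem eq_zero_of_dClawAt_eq_zero (s s' v w : β ⊕ (γ ⊕ δ) → ℂ)
    (hφ : phiFun (β := β) (δ := δ) L s s' v w ≠ 0) {x : Option β × ThetaIdx γ δ → ℂ}
    (hx : x ∈ tangentAt L κM (thetaVec L κM w)) (h0 : dClawAt L κM s v (thetaVec L κM w) x = 0) :
    x = 0 := by
  set p := thetaVec L κM w with hp
  -- (1) `d(G∘F) x = 0`
  have hdF : ∀ K, ∑ J, eval p (pderiv J (clawAt L κM s v K)) * x J = 0 := fun K => by
    simpa [dClawAt_apply] using congr_fun h0 K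
  have hGF : ∀ I, ∑ J, eval p (pderiv J (clawGF L κM s s' v I)) * x J = 0 := by
    intro I
    calc ∑ J, eval p (pderiv J (clawGF L κM s s' v I)) * x J
        = ∑ J, ∑ K, eval (fun K' => eval p (clawAt L κM s v K')) (pderiv K (clawAt L κM s' (-v) I)) *
            eval p (pderiv J (clawAt L κM s v K)) * x J := by
          refine Finset.sum_congr rfl fun J _ => ?_
          rw [clawGF, eval_pderiv_bind₁, Finset.sum_mul]
      _ = ∑ K, eval (fun K' => eval p (clawAt L κM s v K')) (pderiv K (clawAt L κM s' (-v) I)) *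
            ∑ J, eval p (pderiv J (clawAt L κM s v K)) * x J := by
          rw [Finset.sum_comm]
          refine Finset.sum_congr rfl fun K _ => ?_
          rw [Finset.mul_sum]
          exact Finset.sum_congr rfl fun J _ => by ring
      _ = 0 := Finset.sum_eq_zero fun K _ => by rw [hdF K, mul_zero]
  -- (2) the minors: `φ (p_I x_K - p_K x_I) = 0`
  have hGFp : ∀ I, eval p (clawGF L κM s s' v I) = phiFun (β := β) (δ := δ) L s s' v w * p I := fun I => by
    rw [hp, eval_clawGF_thetaVec]
    rfl
  have hmin : ∀ I K, phiFun (β := β) (δ := δ) L s s' v w * (p I * x K - p K * x I) = 0 := by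
    intro I K
    have h := hx _ (minorRel_mem_relSet L κM s s' v I K)
    rw [sum_grad_minorRel, hGF I, hGF K, hGFp I, hGFp K] at h
    linear_combination h
  -- (3) `x ∥ p`
  obtain ⟨K₀, hK₀⟩ := exists_theta_ne_zero L κM w
  have hpK₀ : p K₀ ≠ 0 := hK₀
  have hpar : x = (x K₀ / p K₀) • p := by
    funext I
    have h := (mul_eq_zero.mp (hmin I K₀)).resolve_left hφ
    simp only [Pi.smul_apply, smul_eq_mul]
    field_simp
    linear_combination -h
  -- (4) Euler's identity for the form `(G∘F)_{K₀}` of degree `16`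
  have hE : ∑ J, eval p (pderiv J (clawGF L κM s s' v K₀)) * p J =
      16 * (phiFun (β := β) (δ := δ) L s s' v w * p K₀) := by
    have h := sum_mul_eval_pderiv_of_isHomogeneous (clawGF_isHomogeneous L κM s s' v K₀) p
    rw [hGFp K₀] at h
    push_cast at h
    rw [← h]
    exact Finset.sum_congr rfl fun J _ => mul_comm _ _
  have h4 := hGF K₀
  rw [hpar] at h4
  simp only [Pi.smul_apply, smul_eq_mul] at h4
  have h5 : x K₀ / p K₀ * (16 * (phiFun (β := β) (δ := δ) L s s' v w * p K₀)) = 0 := by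
    rw [← hE, Finset.mul_sum, ← h4]
    exact Finset.sum_congr rfl fun J _ => by ring
  have ht : x K₀ / p K₀ = 0 := by
    refine (mul_eq_zero.mp h5).resolve_right ?_
    exact mul_ne_zero (by norm_num) (mul_ne_zero hφ hpK₀)
  rw [hpar, ht, zero_smul]

/-- **Transport of the tangent space along the group**: `dim T(Θ(w)) ≤ dim T(Θ(w + v))` for all
`w, v` — the formal differential of a composite law good at `(w, v)` (complete system!) embeds
`T(Θ(w))` into `T(U·Θ(w+v)) = T(Θ(w+v))`. [cite: NesterenkoPhilippon2001, Ch. 11 §2.2 (i)] -/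
theorem finrank_tangentAt_theta_le (w v : β ⊕ (γ ⊕ δ) → ℂ) :
    finrank ℂ (tangentAt L κM (thetaVec L κM w)) ≤ finrank ℂ (tangentAt L κM (thetaVec L κM (w + v))) := by
  obtain ⟨i, hi⟩ := exists_clawUnit_clawFamily_ne_zero (β := β) (δ := δ) L w v
  obtain ⟨i', hi'⟩ := exists_clawUnit_clawFamily_ne_zero (β := β) (δ := δ) L (w + v) (-v)
  have hφ : phiFun (β := β) (δ := δ) L (clawFamily (β := β) (δ := δ) L i)
      (clawFamily (β := β) (δ := δ) L i') v w ≠ 0 :=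
    mul_ne_zero (pow_ne_zero _ hi) hi'
  have hF : (fun I => eval (thetaVec L κM w) (clawAt L κM (clawFamily (β := β) (δ := δ) L i) v I)) =
      clawUnit (β := β) (δ := δ) L (clawFamily (β := β) (δ := δ) L i) w v • thetaVec L κM (w + v) := by
    funext I
    rw [eval_clawAt_thetaVec]
    rfl
  let Φ : tangentAt L κM (thetaVec L κM w) →ₗ[ℂ] tangentAt L κM (thetaVec L κM (w + v)) :=
    (dClawAt L κM (clawFamily (β := β) (δ := δ) L i) v (thetaVec L κM w)).restrict fun x hx => by
      have h := dClawAt_mem_tangentAt L κM (clawFamily (β := β) (δ := δ) L i) v hx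
      rwa [hF, tangentAt_smul L κM hi] at h
  have hinj : Function.Injective Φ := by
    intro x y hxy
    apply Subtype.ext
    have h : dClawAt L κM (clawFamily (β := β) (δ := δ) L i) v (thetaVec L κM w) (x.1 - y.1) = 0 := by
      rw [map_sub, sub_eq_zero]
      simpa [Φ, LinearMap.coe_restrict_apply] using congrArg Subtype.val hxy
    exact sub_eq_zero.mp
      (eq_zero_of_dClawAt_eq_zero L κM _ _ v w hφ (Submodule.sub_mem _ x.2 y.2) h)
  exact LinearMap.finrank_le_finrank_of_injective hinj

/-- **Monotonicity in the form used below**: `dim T(Θ(w)) ≤ dim T(Θ(w₀))` for every reference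
point `w₀`. [folklore] -/
theorem finrank_tangentAt_theta_le' (w w₀ : β ⊕ (γ ⊕ δ) → ℂ) :
    finrank ℂ (tangentAt L κM (thetaVec L κM w)) ≤ finrank ℂ (tangentAt L κM (thetaVec L κM w₀)) := by
  have h := finrank_tangentAt_theta_le L κM w (w₀ - w)
  rwa [add_sub_cancel] at h

/-! ### Gradient pairings of monomials; polynomials in few variables -/

open Classical in
omit [Fintype β] [Fintype δ] [DecidableEq γ] in
/-- `∂_K X_A` evaluated. [folklore] -/
theorem eval_pderiv_X (p : Option β × ThetaIdx γ δ → ℂ) (K A : Option β × ThetaIdx γ δ) :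
    eval p (pderiv K (X A : MvPolynomial (Option β × ThetaIdx γ δ) ℂ)) = if A = K then 1 else 0 := by
  rw [pderiv_X]
  by_cases h : A = K
  · subst h; simp
  · simp [h]

/-- `∑_K ∂_K(X_A)(p) v_K = v_A`. [folklore] -/
theorem sum_grad_X (p v : Option β × ThetaIdx γ δ → ℂ) (A : Option β × ThetaIdx γ δ) :
    ∑ K, eval p (pderiv K (X A : MvPolynomial (Option β × ThetaIdx γ δ) ℂ)) * v K = v A := by
  classical
  simp only [eval_pderiv_X, ite_mul, one_mul, zero_mul, Finset.sum_ite_eq, Finset.mem_univ, if_true]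

/-- `∑_K ∂_K(X_A X_B)(p) v_K = p_B v_A + p_A v_B`. [folklore] -/
theorem sum_grad_X_mul_X (p v : Option β × ThetaIdx γ δ → ℂ) (A B : Option β × ThetaIdx γ δ) :
    ∑ K, eval p (pderiv K (X A * X B : MvPolynomial (Option β × ThetaIdx γ δ) ℂ)) * v K =
      p B * v A + p A * v B := by
  have h : ∀ K, eval p (pderiv K (X A * X B : MvPolynomial (Option β × ThetaIdx γ δ) ℂ)) * v K =
      p A * (eval p (pderiv K (X B : MvPolynomial (Option β × ThetaIdx γ δ) ℂ)) * v K) +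
        p B * (eval p (pderiv K (X A : MvPolynomial (Option β × ThetaIdx γ δ) ℂ)) * v K) := by
    intro K
    rw [Derivation.leibniz, smul_eq_mul, smul_eq_mul, map_add, map_mul, map_mul, eval_X, eval_X]
    ring
  simp only [h, Finset.sum_add_distrib, ← Finset.mul_sum, sum_grad_X]
  ring

/-- `∑_K ∂_K(X_A X_B²)(p) v_K = p_B² v_A + 2 p_A p_B v_B`. [folklore] -/
theorem sum_grad_X_mul_X_sq (p v : Option β × ThetaIdx γ δ → ℂ) (A B : Option β × ThetaIdx γ δ) :
    ∑ K, eval p (pderiv K (X A * X B ^ 2 : MvPolynomial (Option β × ThetaIdx γ δ) ℂ)) * v K =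
      p B ^ 2 * v A + 2 * p A * p B * v B := by
  have h : ∀ K, eval p (pderiv K (X A * X B ^ 2 : MvPolynomial (Option β × ThetaIdx γ δ) ℂ)) * v K =
      2 * p A * p B * (eval p (pderiv K (X B : MvPolynomial (Option β × ThetaIdx γ δ) ℂ)) * v K) +
        p B ^ 2 * (eval p (pderiv K (X A : MvPolynomial (Option β × ThetaIdx γ δ) ℂ)) * v K) := by
    intro K
    simp only [Derivation.leibniz, pderiv_pow, smul_eq_mul, map_add, map_mul, map_pow,
      map_ofNat, eval_X, Nat.cast_ofNat]
    ring
  simp only [h, Finset.sum_add_distrib, ← Finset.mul_sum, sum_grad_X]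
  ring

omit [Fintype β] [Fintype δ] in
/-- **Polynomials in variables on which `v` vanishes pair to zero with `v`.** [folklore] -/
theorem sum_grad_eq_zero_of_mem_supported {S : Set (Option β × ThetaIdx γ δ)}
    {R : MvPolynomial (Option β × ThetaIdx γ δ) ℂ} (hR : R ∈ supported ℂ S)
    (p : Option β × ThetaIdx γ δ → ℂ) {v : Option β × ThetaIdx γ δ → ℂ} (hv : ∀ K ∈ S, v K = 0)
    [Fintype β] [Fintype δ] :
    ∑ K, eval p (pderiv K R) * v K = 0 := by
  rw [mem_supported] at hR
  refine Finset.sum_eq_zero fun K _ => ?_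
  by_cases hK : K ∈ S
  · rw [hv K hK, mul_zero]
  · rw [pderiv_eq_zero_of_notMem_vars (fun h => hK (hR h)), map_zero, zero_mul]

omit [Fintype β] [Fintype γ] [Fintype δ] [DecidableEq γ] in
/-- `X_K ∈ supported S` for `K ∈ S`. [folklore] -/
theorem X_mem_supported_of_mem {S : Set (Option β × ThetaIdx γ δ)} {K : Option β × ThetaIdx γ δ}
    (hK : K ∈ S) : (X K : MvPolynomial (Option β × ThetaIdx γ δ) ℂ) ∈ supported ℂ S :=
  X_mem_supported.mpr hK

omit [Fintype β] [Fintype γ] [Fintype δ] [DecidableEq γ] in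
/-- `C c ∈ supported S`. [folklore] -/
theorem C_mem_supported (S : Set (Option β × ThetaIdx γ δ)) (c : ℂ) :
    (C c : MvPolynomial (Option β × ThetaIdx γ δ) ℂ) ∈ supported ℂ S :=
  Subalgebra.algebraMap_mem _ c

/-! ### Jet identities of the blocks -/

/-- **The exchange identities** `Z_i P₀ - Z₀ P_i = [i = 2]·2P₁²` (exact polynomial identities in
the sigma jets). [folklore] -/
theorem univExtZ_mul_univExtP_zero_sub (i : Fin 3) (z : ℂ) :
    L.univExtZ i z * L.univExtP 0 z - L.univExtZ 0 z * L.univExtP i z =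
      if i = 2 then 2 * L.univExtP 1 z ^ 2 else 0 := by
  fin_cases i <;>
    simp [PeriodPair.univExtZ_zero, PeriodPair.univExtZ_one, PeriodPair.univExtZ_two,
      PeriodPair.univExtP_zero, PeriodPair.univExtP_one, PeriodPair.univExtP_two] <;> ring

/-- **The Weierstrass cubic on the blocks**: `P₀P₂² - 4P₁³ + g₂P₀²P₁ + g₃P₀³ = 0` everywhere
(off the lattice this is `σ⁹(℘′² - 4℘³ + g₂℘ + g₃) = 0`; by continuity on the lattice).
[folklore] -/
theorem univExtP_cubic (z : ℂ) :
    L.univExtP 0 z * L.univExtP 2 z ^ 2 - 4 * L.univExtP 1 z ^ 3 +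
      L.g₂ * L.univExtP 0 z ^ 2 * L.univExtP 1 z + L.g₃ * L.univExtP 0 z ^ 3 = 0 := by
  set f : ℂ → ℂ := fun z => L.univExtP 0 z * L.univExtP 2 z ^ 2 - 4 * L.univExtP 1 z ^ 3 +
      L.g₂ * L.univExtP 0 z ^ 2 * L.univExtP 1 z + L.g₃ * L.univExtP 0 z ^ 3 with hf
  have hcont : Continuous f := by
    have h := fun i => (L.differentiable_univExtP i).continuous
    simp only [hf]
    fun_prop
  have hΛ : (L.lattice : Set ℂ).Countable := by
    have : (L.lattice : Set ℂ) ⊆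
        Set.range (fun q : ℤ × ℤ => (q.1 : ℂ) * L.ω₁ + (q.2 : ℂ) * L.ω₂) := by
      intro x hx
      obtain ⟨a, b, h⟩ := PeriodPair.mem_lattice.mp hx
      exact ⟨(a, b), h⟩
    exact (Set.countable_range _).mono this
  have hdense : Dense ((L.lattice : Set ℂ)ᶜ) := hΛ.dense_compl ℂ
  have heq : f = fun _ => 0 := by
    refine Continuous.ext_on hdense hcont continuous_const fun z hz => ?_
    have hz : z ∉ L.lattice := hz
    obtain ⟨h0, h1, h2⟩ := L.univExtP_eq hz
    simp only [hf, h0, h1, h2]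
    have hsq := L.derivWeierstrassP_sq z hz
    linear_combination L.weierstrassSigma z ^ 9 * hsq
  exact congr_fun heq z

/-! ### The reference point -/

/-- A point `z₀` with `z₀ ∉ Λ` and `2z₀ ∉ Λ` (countably many exclusions). [folklore] -/
theorem exists_refScalar : ∃ z : ℂ, z ∉ L.lattice ∧ 2 * z ∉ L.lattice := by
  have hΛ : (L.lattice : Set ℂ).Countable := by
    have : (L.lattice : Set ℂ) ⊆
        Set.range (fun q : ℤ × ℤ => (q.1 : ℂ) * L.ω₁ + (q.2 : ℂ) * L.ω₂) := by
      intro x hx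
      obtain ⟨a, b, h⟩ := PeriodPair.mem_lattice.mp hx
      exact ⟨(a, b), h⟩
    exact (Set.countable_range _).mono this
  have hc : ((L.lattice : Set ℂ) ∪ (fun l : ℂ => l / 2) '' (L.lattice : Set ℂ)).Countable :=
    hΛ.union (hΛ.image _)
  obtain ⟨z, hz⟩ := (hc.dense_compl ℂ).nonempty
  simp only [Set.mem_compl_iff, Set.mem_union, Set.mem_image, SetLike.mem_coe, not_or, not_exists,
    not_and] at hz
  exact ⟨z, hz.1, fun h => hz.2 _ h (by ring)⟩

/-- **The reference scalar `z₀`.** [folklore] -/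
def refScalar : ℂ := Classical.choose (exists_refScalar L)

/-- `z₀ ∉ Λ`. [folklore] -/
theorem refScalar_notMem : refScalar L ∉ L.lattice := (Classical.choose_spec (exists_refScalar L)).1

/-- `2z₀ ∉ Λ`. [folklore] -/
theorem two_mul_refScalar_notMem : 2 * refScalar L ∉ L.lattice :=
  (Classical.choose_spec (exists_refScalar L)).2

/-- **The reference point `w₀`**: `y = 0`, all `z_b = z₀`, `s = 0`. [folklore] -/
def refPt : β ⊕ (γ ⊕ δ) → ℂ := fun k => Sum.elim (fun _ => 0) (Sum.elim (fun _ => refScalar L) fun _ => 0) k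

omit [Fintype β] [Fintype γ] [Fintype δ] [DecidableEq γ] in
/-- The `E`-coordinates of `w₀`. [folklore] -/
@[simp] theorem refPt_iz (b : γ) : refPt (β := β) (δ := δ) L (iz b) = refScalar L := by
  simp [refPt, iz]

/-- `P₀(z₀) ≠ 0`. [folklore] -/
theorem univExtP_zero_refScalar_ne_zero : L.univExtP 0 (refScalar L) ≠ 0 := by
  rw [(L.univExtP_eq (refScalar_notMem L)).1]
  exact pow_ne_zero 3 (L.weierstrassSigma_ne_zero (refScalar_notMem L))

/-- `P₂(z₀) ≠ 0` (`℘′(z₀) ≠ 0` as `2z₀ ∉ Λ`). [folklore] -/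
theorem univExtP_two_refScalar_ne_zero : L.univExtP 2 (refScalar L) ≠ 0 := by
  rw [(L.univExtP_eq (refScalar_notMem L)).2.2]
  refine mul_ne_zero (pow_ne_zero 3 (L.weierstrassSigma_ne_zero (refScalar_notMem L))) fun h => ?_
  exact two_mul_refScalar_notMem L (L.two_mul_mem_lattice_of_derivWeierstrassP_eq_zero (refScalar_notMem L) h)

omit [Fintype β] [Fintype δ] [DecidableEq γ] in
/-- `Θ^P_{(M,none)}(w₀) = ∏_b P_{M_b}(z₀)`. [folklore] -/
theorem thetaPnone_refPt (M : γ → Fin 3) :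
    thetaPnone (β := β) (δ := δ) L M (refPt L) = ∏ b, L.univExtP (M b) (refScalar L) := by
  simp [thetaPnone]

omit [Fintype β] [Fintype δ] in
/-- `Θ_{J₀}(w₀) ≠ 0` for `J₀ = (none, (0, none))`. [folklore] -/
theorem theta_baseIdx_refPt_ne_zero :
    theta L κM ((none, ((0 : γ → Fin 3), none)) : Option β × ThetaIdx γ δ) (refPt L) ≠ 0 := by
  simp only [theta, thetaT_none, thetaP_none, one_mul, thetaPnone_refPt, Pi.zero_apply]
  exact Finset.prod_ne_zero_iff.mpr fun b _ => univExtP_zero_refScalar_ne_zero L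

omit [Fintype β] [Fintype δ] in
/-- `Θ_{(none,(2δ_b,none))}(w₀) ≠ 0`. [folklore] -/
theorem theta_single_two_refPt_ne_zero (b : γ) :
    theta L κM ((none, (Pi.single b (2 : Fin 3), none)) : Option β × ThetaIdx γ δ) (refPt L) ≠ 0 := by
  simp only [theta, thetaT_none, thetaP_none, one_mul, thetaPnone_refPt]
  refine Finset.prod_ne_zero_iff.mpr fun c _ => ?_
  by_cases h : c = b
  · subst h
    rw [Pi.single_eq_same]
    exact univExtP_two_refScalar_ne_zero L
  · rw [Pi.single_eq_of_ne h]
    exact univExtP_zero_refScalar_ne_zero L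

/-! ### Coordinates and ranks -/

/-- **The `n + 1` coordinates at `w₀`**: `J₀ = (none,(0,none))`, `(j,(0,none))`, `(none,(δ_b,none))`,
`(none,(0,e))`. [folklore] -/
def coordIdx : Option (β ⊕ (γ ⊕ δ)) → Option β × ThetaIdx γ δ
  | none => (none, (0, none))
  | some (Sum.inl j) => (some j, (0, none))
  | some (Sum.inr (Sum.inl b)) => (none, (Pi.single b 1, none))
  | some (Sum.inr (Sum.inr e)) => (none, (0, some e))

/-- **The rank** of a theta index (the order in which the relations at `w₀` are triangular):
number of non-zero blocks for the block indices, then the fibre indices, then the torus indices.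
[folklore] -/
def rank : Option β × ThetaIdx γ δ → ℕ
  | (none, (M, none)) => (Finset.univ.filter fun b => M b ≠ 0).card
  | (none, (_, some _)) => Fintype.card γ + 1
  | (some _, _) => Fintype.card γ + 2

omit [Fintype β] [Fintype δ] [DecidableEq γ] in
/-- Block indices have rank `≤ |γ|`. [folklore] -/
theorem rank_none_none_le (M : γ → Fin 3) :
    rank ((none, (M, none)) : Option β × ThetaIdx γ δ) ≤ Fintype.card γ := by
  simp only [rank]
  exact (Finset.card_filter_le _ _).trans (Finset.card_univ (α := γ)).le

omit [Fintype β] [Fintype δ] in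
/-- A single block has rank `≤ 1`. [folklore] -/
theorem rank_single_le (b : γ) (i : Fin 3) :
    rank ((none, (Pi.single b i, none)) : Option β × ThetaIdx γ δ) ≤ 1 := by
  simp only [rank]
  refine (Finset.card_le_card (t := {b}) fun c hc => ?_).trans (Finset.card_singleton b).le
  rw [Finset.mem_filter] at hc
  rw [Finset.mem_singleton]
  by_contra h
  exact hc.2 (by rw [Pi.single_eq_of_ne h])

omit [Fintype β] [Fintype δ] in
/-- Zeroing a non-zero block lowers the rank. [folklore] -/
theorem rank_update_zero_lt {M : γ → Fin 3} {b : γ} (hb : M b ≠ 0) :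
    rank ((none, (Function.update M b 0, none)) : Option β × ThetaIdx γ δ) <
      rank ((none, (M, none)) : Option β × ThetaIdx γ δ) := by
  simp only [rank]
  refine Finset.card_lt_card ⟨fun c hc => ?_, fun h => ?_⟩
  · rw [Finset.mem_filter] at hc ⊢
    refine ⟨hc.1, fun h0 => hc.2 ?_⟩
    by_cases hcb : c = b
    · subst hcb; simp
    · rwa [Function.update_of_ne hcb]
  · have := h (Finset.mem_filter.mpr ⟨Finset.mem_univ b, hb⟩)
    rw [Finset.mem_filter] at this
    exact this.2 (by simp)

omit [Fintype β] [Fintype γ] [Fintype δ] in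
/-- The coordinates are pairwise distinct. [folklore] -/
theorem coordIdx_injective : Function.Injective (coordIdx (β := β) (γ := γ) (δ := δ)) := by
  have h10 : ∀ b : γ, (Pi.single b (1 : Fin 3) : γ → Fin 3) ≠ 0 := fun b h => by
    have := congr_fun h b
    simp at this
  rintro (_ | j | b | e) (_ | j' | b' | e') h <;>
    simp only [coordIdx, Prod.mk.injEq, Option.some.injEq, reduceCtorEq, and_false, false_and,
      and_true, true_and] at h ⊢
  · exact absurd h.symm (h10 b')
  · rw [h]
  · exact absurd h (h10 b)
  · -- `Pi.single b 1 = Pi.single b' 1`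
    by_contra hne
    have := congr_fun h b
    rw [Pi.single_eq_same, Pi.single_eq_of_ne (fun h' => hne (by rw [h']))] at this
    exact one_ne_zero this
  · rw [h]

omit [Fintype β] [Fintype γ] [Fintype δ] in
/-- `n + 1 ≤ N + 1`. [folklore] -/
theorem card_coords_le [Fintype β] [Fintype γ] [Fintype δ] :
    Fintype.card (β ⊕ (γ ⊕ δ)) + 1 ≤ Fintype.card (Option β × ThetaIdx γ δ) := by
  rw [← Fintype.card_option]
  exact Fintype.card_le_of_injective _ coordIdx_injective

/-! ### The relations at the reference point -/

omit [Fintype β] [Fintype δ] in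
/-- Splitting a block product at `b`. [folklore] -/
theorem thetaPnone_eq_mul_prod_erase (N : γ → Fin 3) (w : β ⊕ (γ ⊕ δ) → ℂ) (b : γ) :
    thetaPnone (β := β) (δ := δ) L N w =
      L.univExtP (N b) (w (iz b)) * ∏ c ∈ Finset.univ.erase b, L.univExtP (N c) (w (iz c)) := by
  unfold thetaPnone
  exact (Finset.mul_prod_erase _ _ (Finset.mem_univ b)).symm

omit [Fintype β] [Fintype δ] in
/-- Splitting the block product of a single block. [folklore] -/
theorem thetaPnone_single (w : β ⊕ (γ ⊕ δ) → ℂ) (b : γ) (i : Fin 3) :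
    thetaPnone (β := β) (δ := δ) L (Pi.single b i) w =
      L.univExtP i (w (iz b)) * ∏ c ∈ Finset.univ.erase b, L.univExtP 0 (w (iz c)) := by
  rw [thetaPnone_eq_mul_prod_erase L _ w b, Pi.single_eq_same]
  congr 1
  exact Finset.prod_congr rfl fun c hc => by rw [Pi.single_eq_of_ne (Finset.ne_of_mem_erase hc)]

/-- **Segre relations** `X_{(j,I)} X_{J₀} - X_{(j,(0,∅))} X_{(∅,I)}`. [folklore] -/
def segreRel (j : β) (I : ThetaIdx γ δ) : MvPolynomial (Option β × ThetaIdx γ δ) ℂ :=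
  X (some j, I) * X (none, (0, none)) - X (some j, ((0 : γ → Fin 3), none)) * X (none, I)

omit [Fintype β] [Fintype δ] in
/-- The Segre relations are relations. [folklore] -/
theorem segreRel_mem_relSet (j : β) (I : ThetaIdx γ δ) : segreRel j I ∈ relSet L κM := by
  refine ⟨⟨2, ?_⟩, fun w => ?_⟩
  · unfold segreRel
    have h1 : (X (some j, I) * X (none, (0, none)) : MvPolynomial (Option β × ThetaIdx γ δ) ℂ).IsHomogeneous 2 := by
      simpa using (isHomogeneous_X ℂ _).mul (isHomogeneous_X ℂ _)
    have h2 : (X (some j, ((0 : γ → Fin 3), none)) * X (none, I) :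
        MvPolynomial (Option β × ThetaIdx γ δ) ℂ).IsHomogeneous 2 := by
      simpa using (isHomogeneous_X ℂ _).mul (isHomogeneous_X ℂ _)
    exact h1.sub h2
  · simp only [segreRel, thetaEval, map_sub, map_mul, eval_X, theta, thetaT_none, one_mul]
    ring

/-- **Block Segre relations** `X_{(M,∅)} X_{J₀} - X_{(M[b↦0],∅)} X_{(M_b δ_b,∅)}`. [folklore] -/
def blockSegreRel (M : γ → Fin 3) (b : γ) : MvPolynomial (Option β × ThetaIdx γ δ) ℂ :=
  X (none, (M, none)) * X (none, (0, none)) -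
    X (none, (Function.update M b 0, none)) * X ((none : Option β), (Pi.single b (M b), (none : Option δ)))

omit [Fintype β] [Fintype δ] in
/-- The block Segre relations are relations. [folklore] -/
theorem blockSegreRel_mem_relSet (M : γ → Fin 3) (b : γ) :
    blockSegreRel (β := β) (δ := δ) M b ∈ relSet L κM := by
  refine ⟨⟨2, ?_⟩, fun w => ?_⟩
  · unfold blockSegreRel
    have h1 : (X (none, (M, none)) * X (none, (0, none)) : MvPolynomial (Option β × ThetaIdx γ δ) ℂ).IsHomogeneous 2 := by
      simpa using (isHomogeneous_X ℂ _).mul (isHomogeneous_X ℂ _)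
    have h2 : (X (none, (Function.update M b 0, none)) * X ((none : Option β), (Pi.single b (M b), (none : Option δ))) :
        MvPolynomial (Option β × ThetaIdx γ δ) ℂ).IsHomogeneous 2 := by
      simpa using (isHomogeneous_X ℂ _).mul (isHomogeneous_X ℂ _)
    exact h1.sub h2
  · simp only [blockSegreRel, thetaEval, map_sub, map_mul, eval_X, theta, thetaT_none, thetaP_none,
      one_mul, sub_eq_zero]
    unfold thetaPnone
    rw [← Finset.prod_mul_distrib, ← Finset.prod_mul_distrib]
    refine Finset.prod_congr rfl fun c _ => ?_
    by_cases hc : c = b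
    · subst hc
      rw [Function.update_self, Pi.single_eq_same, Pi.zero_apply, mul_comm]
    · rw [Function.update_of_ne hc, Pi.single_eq_of_ne hc, Pi.zero_apply]

/-- **The Weierstrass cubic in block `b`**:
`X_{J₀} X_{(2δ_b)}² - 4X_{(δ_b)}³ + g₂ X_{J₀}² X_{(δ_b)} + g₃ X_{J₀}³`. [folklore] -/
def cubicRel (b : γ) : MvPolynomial (Option β × ThetaIdx γ δ) ℂ :=
  X (none, (0, none)) * X ((none : Option β), (Pi.single b (2 : Fin 3), (none : Option δ))) ^ 2 +
    (-(C 4 * X ((none : Option β), (Pi.single b (1 : Fin 3), (none : Option δ))) ^ 3) +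
      C L.g₂ * X (none, (0, none)) ^ 2 * X ((none : Option β), (Pi.single b (1 : Fin 3), (none : Option δ))) +
        C L.g₃ * X ((none : Option β), ((0 : γ → Fin 3), (none : Option δ))) ^ 3)

omit [Fintype β] [Fintype δ] in
/-- The cubic relations are relations. [folklore] -/
theorem cubicRel_mem_relSet (b : γ) : cubicRel (β := β) (δ := δ) L b ∈ relSet L κM := by
  refine ⟨⟨3, ?_⟩, fun w => ?_⟩
  · have h1 : (X (none, (0, none)) * X ((none : Option β), (Pi.single b (2 : Fin 3), (none : Option δ))) ^ 2 :
        MvPolynomial (Option β × ThetaIdx γ δ) ℂ).IsHomogeneous 3 := by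
      simpa using (isHomogeneous_X ℂ _).mul ((isHomogeneous_X ℂ _).pow 2)
    have h2 : (C 4 * X ((none : Option β), (Pi.single b (1 : Fin 3), (none : Option δ))) ^ 3 :
        MvPolynomial (Option β × ThetaIdx γ δ) ℂ).IsHomogeneous 3 := by
      simpa using ((isHomogeneous_X ℂ _).pow 3).C_mul 4
    have h3 : (C L.g₂ * X (none, (0, none)) ^ 2 * X ((none : Option β), (Pi.single b (1 : Fin 3), (none : Option δ))) :
        MvPolynomial (Option β × ThetaIdx γ δ) ℂ).IsHomogeneous 3 := by
      simpa [mul_assoc] using (((isHomogeneous_X ℂ _).pow 2).mul (isHomogeneous_X ℂ _)).C_mul L.g₂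
    have h4 : (C L.g₃ * X ((none : Option β), ((0 : γ → Fin 3), (none : Option δ))) ^ 3 :
        MvPolynomial (Option β × ThetaIdx γ δ) ℂ).IsHomogeneous 3 := by
      simpa using ((isHomogeneous_X ℂ _).pow 3).C_mul L.g₃
    unfold cubicRel
    exact h1.add ((h2.neg.add h3).add h4)
  · set E := ∏ c ∈ Finset.univ.erase b, L.univExtP 0 (w (iz c)) with hE
    have hJ0 : theta L κM ((none, ((0 : γ → Fin 3), none)) : Option β × ThetaIdx γ δ) w = L.univExtP 0 (w (iz b)) * E := by
      simp only [theta, thetaT_none, thetaP_none, one_mul]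
      exact thetaPnone_eq_mul_prod_erase L 0 w b
    have hs : ∀ i : Fin 3, theta L κM ((none, (Pi.single b i, none)) : Option β × ThetaIdx γ δ) w = L.univExtP i (w (iz b)) * E := by
      intro i
      simp only [theta, thetaT_none, thetaP_none, one_mul]
      exact thetaPnone_single L w b i
    simp only [cubicRel, thetaEval, map_add, map_neg, map_mul, map_pow, eval_X, eval_C, hJ0, hs]
    have hc := univExtP_cubic L (w (iz b))
    linear_combination E ^ 3 * hc

/-- **The exchange relations of the fibre coordinates**:
`X_{(M,e)}X_{J₀} - X_{(0,e)}X_{(M,∅)} + ∑_{M_b = 2} 2κ_{eb} X_{(M[b↦1],∅)}X_{(δ_b,∅)}`. [folklore] -/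
def fibreRel (M : γ → Fin 3) (e : δ) : MvPolynomial (Option β × ThetaIdx γ δ) ℂ :=
  X (none, (M, some e)) * X (none, (0, none)) -
      X ((none : Option β), ((0 : γ → Fin 3), some e)) * X (none, (M, none)) +
    ∑ b ∈ Finset.univ.filter (fun b => M b = 2), C (2 * (κM e b : ℂ)) *
      (X ((none : Option β), (Function.update M b 1, (none : Option δ))) *
        X ((none : Option β), (Pi.single b (1 : Fin 3), (none : Option δ))))

omit [Fintype β] [Fintype δ] in
/-- The key identity behind the exchange relations (from `Z_iP₀ - Z₀P_i = [i=2]·2P₁²`). [folklore] -/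
theorem fibre_identity (M : γ → Fin 3) (e : δ) (w : β ⊕ (γ ⊕ δ) → ℂ) :
    thetaPsome (β := β) L κM M e w * thetaPnone (β := β) (δ := δ) L 0 w -
        thetaPsome (β := β) L κM 0 e w * thetaPnone (β := β) (δ := δ) L M w +
      ∑ b ∈ Finset.univ.filter (fun b => M b = 2), 2 * (κM e b : ℂ) *
        (thetaPnone (β := β) (δ := δ) L (Function.update M b 1) w * thetaPnone (β := β) (δ := δ) L (Pi.single b 1) w) = 0 := by
  -- the `s`-terms cancel
  have hA : thetaPsome (β := β) L κM M e w * thetaPnone (β := β) (δ := δ) L 0 w -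
      thetaPsome (β := β) L κM 0 e w * thetaPnone (β := β) (δ := δ) L M w =
      (∑ b, (κM e b : ℂ) * (L.univExtZ ((0 : γ → Fin 3) b) (w (iz b)) *
          ∏ b' ∈ Finset.univ.erase b, L.univExtP ((0 : γ → Fin 3) b') (w (iz b')))) * thetaPnone (β := β) (δ := δ) L M w -
        (∑ b, (κM e b : ℂ) * (L.univExtZ (M b) (w (iz b)) *
          ∏ b' ∈ Finset.univ.erase b, L.univExtP (M b') (w (iz b')))) * thetaPnone (β := β) (δ := δ) L 0 w := by
    unfold thetaPsome
    ring
  rw [hA, Finset.sum_mul, Finset.sum_mul, ← Finset.sum_sub_distrib, Finset.sum_filter, ← Finset.sum_add_distrib]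
  refine Finset.sum_eq_zero fun b _ => ?_
  rw [thetaPnone_eq_mul_prod_erase L M w b, thetaPnone_eq_mul_prod_erase L 0 w b, thetaPnone_update,
    thetaPnone_single]
  have hex := univExtZ_mul_univExtP_zero_sub L (M b) (w (iz b))
  simp only [Pi.zero_apply] at hex ⊢
  by_cases h2 : M b = 2
  · rw [if_pos h2] at hex ⊢
    rw [h2] at hex ⊢
    linear_combination (-(κM e b : ℂ)) * (∏ b' ∈ Finset.univ.erase b, L.univExtP 0 (w (iz b'))) *
      (∏ b' ∈ Finset.univ.erase b, L.univExtP (M b') (w (iz b'))) * hex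
  · rw [if_neg h2] at hex ⊢
    linear_combination (-(κM e b : ℂ)) * (∏ b' ∈ Finset.univ.erase b, L.univExtP 0 (w (iz b'))) *
      (∏ b' ∈ Finset.univ.erase b, L.univExtP (M b') (w (iz b'))) * hex

omit [Fintype β] [Fintype δ] in
/-- The exchange relations are relations. [folklore] -/
theorem fibreRel_mem_relSet (M : γ → Fin 3) (e : δ) : fibreRel (β := β) κM M e ∈ relSet L κM := by
  refine ⟨⟨2, ?_⟩, fun w => ?_⟩
  · have hXX : ∀ (A B : Option β × ThetaIdx γ δ) (c : ℂ),
        (C c * (X A * X B) : MvPolynomial (Option β × ThetaIdx γ δ) ℂ).IsHomogeneous 2 := by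
      intro A B c
      simpa using ((isHomogeneous_X ℂ A).mul (isHomogeneous_X ℂ B)).C_mul c
    have hXX' : ∀ A B : Option β × ThetaIdx γ δ,
        (X A * X B : MvPolynomial (Option β × ThetaIdx γ δ) ℂ).IsHomogeneous 2 := by
      intro A B
      simpa using (isHomogeneous_X ℂ A).mul (isHomogeneous_X ℂ B)
    unfold fibreRel
    exact ((hXX' _ _).sub (hXX' _ _)).add (IsHomogeneous.sum _ _ _ fun b _ => hXX _ _ _)
  · have h := fibre_identity L κM M e w
    have hev : thetaEval L κM (fibreRel (β := β) κM M e) w =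
        thetaPsome (β := β) L κM M e w * thetaPnone (β := β) (δ := δ) L 0 w -
            thetaPsome (β := β) L κM 0 e w * thetaPnone (β := β) (δ := δ) L M w +
          ∑ b ∈ Finset.univ.filter (fun b => M b = 2), 2 * (κM e b : ℂ) *
            (thetaPnone (β := β) (δ := δ) L (Function.update M b 1) w *
              thetaPnone (β := β) (δ := δ) L (Pi.single b 1) w) := by
      simp only [fibreRel, thetaEval, map_add, map_sub, map_mul, map_sum, eval_X, eval_C, theta_none_eq,
        thetaP_none, thetaP_some]
    rw [hev, h]

/-! ### The tangent space at the reference point injects into the coordinates -/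

/-- **The generic elimination step at `w₀`.** If `v` is tangent at `Θ(w₀)`, vanishes at `J₀` and
on a set `S` of variables, and `X_J X_{J₀} + R` is a relation with `R ∈ ℂ[X_K ; K ∈ S]`, then
`v_J = 0`. [folklore] -/
theorem refPt_step {v : Option β × ThetaIdx γ δ → ℂ}
    (hv : v ∈ tangentAt L κM (thetaVec L κM (refPt (β := β) (δ := δ) L)))
    (hvJ₀ : v (none, (0, none)) = 0) {J : Option β × ThetaIdx γ δ}
    {S : Set (Option β × ThetaIdx γ δ)} (hvS : ∀ K ∈ S, v K = 0)
    {R : MvPolynomial (Option β × ThetaIdx γ δ) ℂ} (hR : R ∈ supported ℂ S)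
    (hrel : X J * X (none, (0, none)) + R ∈ relSet L κM) : v J = 0 := by
  have hpJ₀ := theta_baseIdx_refPt_ne_zero (β := β) (δ := δ) L κM
  have hsum := hv _ hrel
  simp only [grad_apply, map_add] at hsum
  simp only [add_mul, Finset.sum_add_distrib] at hsum
  rw [sum_grad_X_mul_X, sum_grad_eq_zero_of_mem_supported hR _ hvS, hvJ₀] at hsum
  simp only [mul_zero, add_zero, thetaVec_apply] at hsum
  exact (mul_eq_zero.mp hsum).resolve_left hpJ₀

/-- **The elimination step for `X_{(2δ_b)}`** (the cubic relation; `℘′(z₀) ≠ 0`). [folklore] -/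
theorem refPt_cubic_step {v : Option β × ThetaIdx γ δ → ℂ}
    (hv : v ∈ tangentAt L κM (thetaVec L κM (refPt (β := β) (δ := δ) L)))
    (hvJ₀ : v (none, (0, none)) = 0) (b : γ) (hv1 : v (none, (Pi.single b 1, none)) = 0) :
    v (none, (Pi.single b 2, none)) = 0 := by
  have hpJ₀ := theta_baseIdx_refPt_ne_zero (β := β) (δ := δ) L κM
  have hp2 := theta_single_two_refPt_ne_zero (β := β) (δ := δ) L κM b
  have hsum := hv _ (cubicRel_mem_relSet (β := β) (δ := δ) L κM b)
  set S : Set (Option β × ThetaIdx γ δ) := {(none, (0, none)), (none, (Pi.single b 1, none))} with hS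
  have hvS : ∀ K ∈ S, v K = 0 := by
    intro K hK
    simp only [hS, Set.mem_insert_iff, Set.mem_singleton_iff] at hK
    rcases hK with rfl | rfl
    exacts [hvJ₀, hv1]
  have hX1 : (X ((none : Option β), (Pi.single b (1 : Fin 3), (none : Option δ))) :
      MvPolynomial (Option β × ThetaIdx γ δ) ℂ) ∈ supported ℂ S :=
    X_mem_supported_of_mem (by simp [hS])
  have hX0 : (X ((none : Option β), ((0 : γ → Fin 3), (none : Option δ))) :
      MvPolynomial (Option β × ThetaIdx γ δ) ℂ) ∈ supported ℂ S :=
    X_mem_supported_of_mem (by simp [hS])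
  have hR : (-(C 4 * X ((none : Option β), (Pi.single b (1 : Fin 3), (none : Option δ))) ^ 3) +
      C L.g₂ * X (none, (0, none)) ^ 2 * X ((none : Option β), (Pi.single b (1 : Fin 3), (none : Option δ))) +
        C L.g₃ * X ((none : Option β), ((0 : γ → Fin 3), (none : Option δ))) ^ 3 :
          MvPolynomial (Option β × ThetaIdx γ δ) ℂ) ∈ supported ℂ S := by
    refine Subalgebra.add_mem _ (Subalgebra.add_mem _ ?_ ?_) ?_
    · exact Subalgebra.neg_mem _ (Subalgebra.mul_mem _ (C_mem_supported _ _) (Subalgebra.pow_mem _ hX1 3))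
    · exact Subalgebra.mul_mem _ (Subalgebra.mul_mem _ (C_mem_supported _ _) (Subalgebra.pow_mem _ hX0 2)) hX1
    · exact Subalgebra.mul_mem _ (C_mem_supported _ _) (Subalgebra.pow_mem _ hX0 3)
  have hrest := sum_grad_eq_zero_of_mem_supported hR (thetaVec L κM (refPt (β := β) (δ := δ) L)) hvS
  simp only [cubicRel, grad_apply, map_add] at hsum
  simp only [map_add] at hrest
  simp only [add_mul, Finset.sum_add_distrib] at hsum hrest
  rw [sum_grad_X_mul_X_sq, hvJ₀, add_assoc, hrest] at hsum
  simp only [mul_zero, zero_add, add_zero, thetaVec_apply] at hsum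
  exact (mul_eq_zero.mp hsum).resolve_left (mul_ne_zero (mul_ne_zero two_ne_zero hpJ₀) hp2)

/-- **Triangularity.** A tangent vector at `Θ(w₀)` vanishing on the `n + 1` coordinates vanishes:
a non-zero component of minimal rank is the leading variable of one of the relations above, whose
other variables are coordinates or of smaller rank. [folklore] -/
theorem eq_zero_of_mem_tangentAt_refPt {v : Option β × ThetaIdx γ δ → ℂ}
    (hv : v ∈ tangentAt L κM (thetaVec L κM (refPt (β := β) (δ := δ) L)))
    (h0 : ∀ c, v (coordIdx c) = 0) : v = 0 := by
  classical
  by_contra hne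
  have hvJ₀ : v (none, (0, none)) = 0 := h0 none
  -- a non-zero component of minimal rank
  obtain ⟨J, hJ, hmin⟩ : ∃ J, v J ≠ 0 ∧ ∀ K, v K ≠ 0 → rank J ≤ rank K := by
    have hS : ∃ J, v J ≠ 0 := by
      by_contra h
      push Not at h
      exact hne (funext h)
    obtain ⟨J₁, hJ₁⟩ := hS
    have hne' : (Finset.univ.filter fun K => v K ≠ 0).Nonempty :=
      ⟨J₁, Finset.mem_filter.mpr ⟨Finset.mem_univ _, hJ₁⟩⟩
    obtain ⟨J, hJm, hJmin⟩ := Finset.exists_min_image _ (rank (β := β) (γ := γ) (δ := δ)) hne'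
    exact ⟨J, (Finset.mem_filter.mp hJm).2, fun K hK =>
      hJmin K (Finset.mem_filter.mpr ⟨Finset.mem_univ _, hK⟩)⟩
  -- the "lower" variables, on which `v` vanishes
  let Low : Set (Option β × ThetaIdx γ δ) :=
    {K | K ∈ Set.range (coordIdx (β := β) (γ := γ) (δ := δ)) ∨ rank K < rank J}
  have hvLow : ∀ K ∈ Low, v K = 0 := by
    rintro K (⟨c, rfl⟩ | hK)
    · exact h0 c
    · by_contra hvK
      exact absurd (hmin K hvK) (not_le.mpr hK)
  have hcoord : ∀ c, coordIdx c ∈ Low := fun c => Or.inl ⟨c, rfl⟩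
  obtain ⟨a, M, o⟩ := J
  rcases a with _ | j
  · rcases o with _ | e
    · -- a block index `(none, (M, none))`
      have hM0 : M ≠ 0 := by
        rintro rfl
        exact hJ (h0 none)
      obtain ⟨b, hb⟩ : ∃ b, M b ≠ 0 := by
        by_contra h
        push Not at h
        exact hM0 (funext h)
      by_cases hsupp : ∀ c, c ≠ b → M c = 0
      · -- a single block: `M = 2δ_b` (as `δ_b` is a coordinate); the cubic relation
        have h1 : M b ≠ 1 := by
          intro h1
          apply hJ
          have hM : M = Pi.single b 1 := by
            funext c
            by_cases hc : c = b
            · subst hc; simpa using h1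
            · rw [Pi.single_eq_of_ne hc, hsupp c hc]
          rw [hM]
          exact h0 (some (Sum.inr (Sum.inl b)))
        have hMb : M b = 2 := by
          revert hb h1
          generalize M b = t
          intro hb h1
          fin_cases t <;> simp_all
        have hM : M = Pi.single b 2 := by
          funext c
          by_cases hc : c = b
          · subst hc; simpa using hMb
          · rw [Pi.single_eq_of_ne hc, hsupp c hc]
        rw [hM] at hJ
        exact hJ (refPt_cubic_step L κM hv hvJ₀ b (h0 (some (Sum.inr (Sum.inl b)))))
      · -- at least two blocks: the block Segre relation
        push Not at hsupp
        obtain ⟨c, hcb, hc⟩ := hsupp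
        have hrank2 : 2 ≤ rank ((none, (M, none)) : Option β × ThetaIdx γ δ) := by
          simp only [rank]
          have hsub : ({b, c} : Finset γ) ⊆ Finset.univ.filter fun b' => M b' ≠ 0 := by
            intro x hx
            rw [Finset.mem_insert, Finset.mem_singleton] at hx
            rw [Finset.mem_filter]
            rcases hx with rfl | rfl
            · exact ⟨Finset.mem_univ _, hb⟩
            · exact ⟨Finset.mem_univ _, hc⟩
          have := Finset.card_le_card hsub
          rwa [Finset.card_pair (Ne.symm hcb)] at this
        refine hJ (refPt_step L κM hv hvJ₀ hvLow
          (R := -(X ((none : Option β), (Function.update M b 0, (none : Option δ))) *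
            X ((none : Option β), (Pi.single b (M b), (none : Option δ))))) ?_ ?_)
        · refine Subalgebra.neg_mem _ (Subalgebra.mul_mem _ (X_mem_supported_of_mem (Or.inr ?_))
            (X_mem_supported_of_mem (Or.inr ?_)))
          · exact rank_update_zero_lt hb
          · exact (rank_single_le b (M b)).trans_lt hrank2
        · have h := blockSegreRel_mem_relSet (β := β) (δ := δ) L κM M b
          rwa [blockSegreRel, sub_eq_add_neg] at h
    · -- a fibre index `(none, (M, some e))`, `M ≠ 0`
      have hM0 : M ≠ 0 := by
        rintro rfl
        exact hJ (h0 (some (Sum.inr (Sum.inr e))))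
      have hrankJ : rank ((none, (M, some e)) : Option β × ThetaIdx γ δ) = Fintype.card γ + 1 := rfl
      refine hJ (refPt_step L κM hv hvJ₀ hvLow
        (R := -(X ((none : Option β), ((0 : γ → Fin 3), some e)) * X (none, (M, none))) +
          ∑ b ∈ Finset.univ.filter (fun b => M b = 2), C (2 * (κM e b : ℂ)) *
            (X ((none : Option β), (Function.update M b 1, (none : Option δ))) *
              X ((none : Option β), (Pi.single b (1 : Fin 3), (none : Option δ))))) ?_ ?_)
      · refine Subalgebra.add_mem _ (Subalgebra.neg_mem _ (Subalgebra.mul_mem _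
          (X_mem_supported_of_mem (hcoord (some (Sum.inr (Sum.inr e)))))
          (X_mem_supported_of_mem (Or.inr ?_)))) (Subalgebra.sum_mem _ fun b _ =>
            Subalgebra.mul_mem _ (C_mem_supported _ _) (Subalgebra.mul_mem _
              (X_mem_supported_of_mem (Or.inr ?_)) (X_mem_supported_of_mem (hcoord (some (Sum.inr (Sum.inl b)))))))
        · rw [hrankJ]
          exact Nat.lt_succ_of_le (rank_none_none_le M)
        · rw [hrankJ]
          exact Nat.lt_succ_of_le (rank_none_none_le _)
      · have h := fibreRel_mem_relSet (β := β) L κM M e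
        have heq : (X (none, (M, some e)) * X (none, (0, none)) +
            (-(X ((none : Option β), ((0 : γ → Fin 3), some e)) * X (none, (M, none))) +
              ∑ b ∈ Finset.univ.filter (fun b => M b = 2), C (2 * (κM e b : ℂ)) *
                (X ((none : Option β), (Function.update M b 1, (none : Option δ))) *
                  X ((none : Option β), (Pi.single b (1 : Fin 3), (none : Option δ))))) :
            MvPolynomial (Option β × ThetaIdx γ δ) ℂ) = fibreRel (β := β) κM M e := by
          unfold fibreRel
          ring
        rwa [← heq] at h
  · -- a torus index `(some j, (M, o))` with `(M, o) ≠ (0, none)`: the Segre relation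
    have hI : rank ((none, (M, o)) : Option β × ThetaIdx γ δ) <
        rank ((some j, (M, o)) : Option β × ThetaIdx γ δ) := by
      rcases o with _ | e
      · exact Nat.lt_of_le_of_lt (rank_none_none_le M) (by simp [rank])
      · simp [rank]
    refine hJ (refPt_step L κM hv hvJ₀ hvLow
      (R := -(X (some j, ((0 : γ → Fin 3), (none : Option δ))) * X (none, (M, o)))) ?_ ?_)
    · exact Subalgebra.neg_mem _ (Subalgebra.mul_mem _ (X_mem_supported_of_mem (hcoord (some (Sum.inl j))))
        (X_mem_supported_of_mem (Or.inr hI)))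
    · have h := segreRel_mem_relSet L κM j (M, o)
      rwa [segreRel, sub_eq_add_neg] at h

/-- **`dim T(Θ(w₀)) ≤ n + 1`**: the tangent space at the reference point injects into the
coordinates. [folklore] -/
theorem finrank_tangentAt_refPt_le :
    finrank ℂ (tangentAt L κM (thetaVec L κM (refPt (β := β) (δ := δ) L))) ≤ Fintype.card (β ⊕ (γ ⊕ δ)) + 1 := by
  let r : tangentAt L κM (thetaVec L κM (refPt (β := β) (δ := δ) L)) →ₗ[ℂ] (Option (β ⊕ (γ ⊕ δ)) → ℂ) :=
    { toFun := fun x c => x.1 (coordIdx c)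
      map_add' := fun x y => rfl
      map_smul' := fun c x => rfl }
  have hinj : Function.Injective r := by
    intro x y hxy
    apply Subtype.ext
    have h := eq_zero_of_mem_tangentAt_refPt L κM (Submodule.sub_mem _ x.2 y.2) fun c => by
      have := congr_fun hxy c
      simpa [r, sub_eq_zero] using this
    exact sub_eq_zero.mp h
  have h := LinearMap.finrank_le_finrank_of_injective hinj
  rwa [Module.finrank_fintype_fun_eq_card, Fintype.card_option] at h

/-- **`dim T(Θ(w)) ≤ n + 1` at every point** (transport + the reference point).
[cite: NesterenkoPhilippon2001, Ch. 11 §2.2 (i)] -/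
theorem finrank_tangentAt_thetaVec_le (w : β ⊕ (γ ⊕ δ) → ℂ) :
    finrank ℂ (tangentAt L κM (thetaVec L κM w)) ≤ Fintype.card (β ⊕ (γ ⊕ δ)) + 1 :=
  (finrank_tangentAt_theta_le' L κM w (refPt (β := β) (δ := δ) L)).trans (finrank_tangentAt_refPt_le L κM)

/-- **The Jacobian criterion for the theta model of `M_κ` (field `locRel` of `AnalyticGroupModel`)**:
at every `w ∈ Lie M_κ,ℂ` there are `N - n` homogeneous relations of the theta functions whose
gradients at `Θ(w)` are linearly independent (`N + 1` = number of theta functions,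
`n = dim M_κ`). [cite: NesterenkoPhilippon2001, Ch. 11 §2.2 (i), Prop. 2.2 (proof)] -/
theorem theta_locRel (w : β ⊕ (γ ⊕ δ) → ℂ) :
    ∃ S : Finset (MvPolynomial (Option β × ThetaIdx γ δ) ℂ),
      (∀ P ∈ S, ∃ d, P.IsHomogeneous d) ∧ (∀ P ∈ S, ∀ w', thetaEval L κM P w' = 0) ∧
      S.card + (Fintype.card (β ⊕ (γ ⊕ δ)) + 1) = Fintype.card (Option β × ThetaIdx γ δ) ∧
      LinearIndependent ℂ fun P : S => fun J => thetaEval L κM (pderiv J P.1) w := by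
  have hle := finrank_tangentAt_thetaVec_le L κM w
  have hc := card_coords_le (β := β) (γ := γ) (δ := δ)
  obtain ⟨S, hS, hcardS, hli⟩ := exists_relations_of_finrank_tangentAt_le L κM (thetaVec L κM w)
    (m := Fintype.card (Option β × ThetaIdx γ δ) - (Fintype.card (β ⊕ (γ ⊕ δ)) + 1)) (by omega)
  exact ⟨S, fun P hP => (hS P hP).1, fun P hP => (hS P hP).2, by omega, hli⟩

end Std

end GaGmE



/-! ### Points of the cone over the Weierstrass cubic -/

/-- **Every non-zero point of the affine cone over the Weierstrass cubic is `c · P(z)`**: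
if `q ≠ 0` and `q₀q₂² - 4q₁³ + g₂q₀²q₁ + g₃q₀³ = 0` then `q = c · (P₀, P₁, P₂)(z)` for some `z`
and `c ≠ 0` (`q₀ ≠ 0`: `(q₁/q₀, q₂/q₀)` is on the affine curve, `℘` takes every value off `Λ` and
`℘′(-z) = -℘′(z)` fixes the sign; `q₀ = 0`: then `q₁ = 0` and `q = -q₂/2 · P(0)`). [folklore] -/
theorem exists_univExtP_eq_smul (L : PeriodPair) (q : Fin 3 → ℂ) (hq : q ≠ 0)
    (hcubic : q 0 * q 2 ^ 2 - 4 * q 1 ^ 3 + L.g₂ * q 0 ^ 2 * q 1 + L.g₃ * q 0 ^ 3 = 0) :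
    ∃ (z c : ℂ), c ≠ 0 ∧ ∀ i, q i = c * L.univExtP i z := by
  by_cases h0 : q 0 = 0
  · have h1 : q 1 = 0 := by
      have h : q 1 ^ 3 = 0 := by
        rw [h0] at hcubic
        linear_combination (-1 / 4 : ℂ) * hcubic
      exact pow_eq_zero_iff (n := 3) (by norm_num) |>.mp h
    have h2 : q 2 ≠ 0 := by
      intro h2
      apply hq
      funext i
      fin_cases i
      · exact h0
      · exact h1
      · exact h2
    obtain ⟨p0, p1, p2⟩ := L.univExtP_at_zero
    refine ⟨0, -q 2 / 2, by simpa using h2, fun i => ?_⟩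
    fin_cases i
    · simp [h0, p0]
    · simp [h1, p1]
    · simp [p2]
  · set X := q 1 / q 0 with hX
    set Y := q 2 / q 0 with hY
    have hcurve : Y ^ 2 = 4 * X ^ 3 - L.g₂ * X - L.g₃ := by
      rw [hX, hY]
      field_simp
      linear_combination hcubic
    obtain ⟨z₁, hz₁, hPz₁⟩ := L.exists_weierstrassP_eq X
    have hsq : ℘'[L] z₁ ^ 2 = Y ^ 2 := by rw [L.derivWeierstrassP_sq z₁ hz₁, hPz₁, hcurve]
    obtain ⟨z, hz, hPz, hP'z⟩ : ∃ z, z ∉ L.lattice ∧ ℘[L] z = X ∧ ℘'[L] z = Y := by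
      rcases sq_eq_sq_iff_eq_or_eq_neg.mp hsq with h | h
      · exact ⟨z₁, hz₁, hPz₁, h⟩
      · refine ⟨-z₁, fun hn => hz₁ (by simpa using L.lattice.neg_mem hn), ?_, ?_⟩
        · rw [L.weierstrassP_neg, hPz₁]
        · rw [L.derivWeierstrassP_neg, h, neg_neg]
    have hσ1 : L.weierstrassSigma z ≠ 0 := L.weierstrassSigma_ne_zero hz
    have hσ : L.weierstrassSigma z ^ 3 ≠ 0 := pow_ne_zero 3 hσ1
    obtain ⟨p0, p1, p2⟩ := L.univExtP_eq hz
    refine ⟨z, q 0 / L.weierstrassSigma z ^ 3, div_ne_zero h0 hσ, fun i => ?_⟩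
    have e0 : q 0 = q 0 / L.weierstrassSigma z ^ 3 * L.weierstrassSigma z ^ 3 := by
      field_simp
    have e1 : q 1 = q 0 / L.weierstrassSigma z ^ 3 * (L.weierstrassSigma z ^ 3 * X) := by
      rw [hX]
      field_simp
    have e2 : q 2 = q 0 / L.weierstrassSigma z ^ 3 * (L.weierstrassSigma z ^ 3 * Y) := by
      rw [hY]
      field_simp
    fin_cases i
    · simpa [p0] using e0
    · simpa [p1, hPz] using e1
    · simpa [p2, hP'z] using e2

/-! ### The exchange identities of a block as quadratic forms -/

/-- The coefficients `(c₁₁, c₂₂, c₀₁, c₀₀)` of the **exchange form** of a block: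
`Z_iP_j - Z_jP_i = c₁₁ P₁² + c₂₂ P₂² + c₀₁ P₀P₁ + c₀₀ P₀²`. [folklore] -/
def _root_.PeriodPair.exchangeCoeff (L : PeriodPair) (i j : Fin 3) : ℂ × ℂ × ℂ × ℂ :=
  if i = 0 ∧ j = 2 then (-2, 0, 0, 0)
  else if i = 2 ∧ j = 0 then (2, 0, 0, 0)
  else if i = 1 ∧ j = 2 then (0, -1 / 2, -L.g₂ / 2, -L.g₃ / 2)
  else if i = 2 ∧ j = 1 then (0, 1 / 2, L.g₂ / 2, L.g₃ / 2)
  else (0, 0, 0, 0)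

/-- **The exchange identities**: `Z_iP_j - Z_jP_i = c₁₁ P₁² + c₂₂ P₂² + c₀₁ P₀P₁ + c₀₀ P₀²` for all
`i, j` and all `z` (`Z₀P₁ = Z₁P₀`, `Z₀P₂ - Z₂P₀ = -2P₁²`,
`2(Z₁P₂ - Z₂P₁) = -(P₂² + g₂P₀P₁ + g₃P₀²)`). [folklore] -/
theorem _root_.PeriodPair.exchange_identity (L : PeriodPair) (i j : Fin 3) (z : ℂ) :
    L.univExtZ i z * L.univExtP j z - L.univExtZ j z * L.univExtP i z =
      (L.exchangeCoeff i j).1 * L.univExtP 1 z ^ 2 + (L.exchangeCoeff i j).2.1 * L.univExtP 2 z ^ 2 +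
        (L.exchangeCoeff i j).2.2.1 * (L.univExtP 0 z * L.univExtP 1 z) +
          (L.exchangeCoeff i j).2.2.2 * L.univExtP 0 z ^ 2 := by
  have h01 := L.univExtZ_zero_mul_univExtP_one z
  have h02 := L.univExtZ_zero_mul_univExtP_two_sub z
  have h12 := L.two_mul_univExtZ_one_mul_univExtP_two_sub z
  fin_cases i <;> fin_cases j <;> simp [PeriodPair.exchangeCoeff]
  · linear_combination h01
  · linear_combination h02
  · linear_combination -h01
  · linear_combination (1 / 2 : ℂ) * h12
  · linear_combination -h02
  · linear_combination (-1 / 2 : ℂ) * h12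

namespace GaGmE

namespace Std

variable {β γ δ : Type} [Fintype β] [Fintype γ] [Fintype δ] [DecidableEq γ]
variable (L : PeriodPair) (κM : δ → γ → Kbar)

/-! ### The boundary forms -/

/-- **The boundary form** of a choice of block charts `M` on the torus indices:
`u_M = ∏_{a : Option β} X_{(a, (M a, none))}` (degree `|β| + 1`). A point of `Ḡ` off all the
`Z(u_M)` has all torus coordinates non-zero and is off the divisor at infinity of the fibres.
[cite: NesterenkoPhilippon2001, Ch. 11 §2.1 (G = Ḡ ∖ Z(𝔞))] -/
def bdryForm (M : Option β → (γ → Fin 3)) : MvPolynomial (Option β × ThetaIdx γ δ) ℂ :=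
  ∏ a : Option β, X (a, (M a, (none : Option δ)))

omit [Fintype γ] [Fintype δ] [DecidableEq γ] in
/-- The boundary forms are forms of degree `|β| + 1`. [folklore] -/
theorem bdryForm_isHomogeneous (M : Option β → (γ → Fin 3)) :
    (bdryForm (δ := δ) M).IsHomogeneous (Fintype.card β + 1) := by
  have h := IsHomogeneous.prod Finset.univ
    (fun a : Option β => (X (a, (M a, (none : Option δ))) : MvPolynomial (Option β × ThetaIdx γ δ) ℂ))
    (fun _ => 1) fun a _ => isHomogeneous_X ℂ _
  simpa [bdryForm, Fintype.card_option] using h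

omit [Fintype γ] [Fintype δ] [DecidableEq γ] in
/-- Evaluation of a boundary form. [folklore] -/
theorem eval_bdryForm (M : Option β → (γ → Fin 3)) (x : Option β × ThetaIdx γ δ → ℂ) :
    eval x (bdryForm (δ := δ) M) = ∏ a : Option β, x (a, (M a, none)) := by
  simp [bdryForm, map_prod]

omit [Fintype β] [Fintype δ] in
/-- **No point of `G` is on the boundary**: at every `w` some boundary form is non-zero at `Θ(w)`
(the block chart of `w` on every torus index). [folklore] -/
theorem exists_eval_bdryForm_ne_zero [Fintype β] [Fintype δ] (w : β ⊕ (γ ⊕ δ) → ℂ) :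
    ∃ M : Option β → (γ → Fin 3), eval (thetaVec L κM w) (bdryForm (δ := δ) M) ≠ 0 := by
  classical
  -- the block chart of `w`
  let M₀ : γ → Fin 3 := fun b => if w (iz b) ∈ L.lattice then 2 else 0
  have hM : ∀ b, L.univExtP (M₀ b) (w (iz b)) ≠ 0 := by
    intro b
    by_cases hb : w (iz b) ∈ L.lattice
    · obtain ⟨m', n', hmn⟩ := PeriodPair.mem_lattice.mp hb
      obtain ⟨c, hc, -, -, h2, -⟩ := L.exists_univExtTheta_lattice m' n' 0
      simp only [PeriodPair.univExtTheta_inl] at h2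
      have : M₀ b = 2 := if_pos hb
      rw [this, ← hmn, h2]
      exact mul_ne_zero hc (by norm_num)
    · have : M₀ b = 0 := if_neg hb
      rw [this, (PeriodPair.univExtP_eq hb).1]
      exact pow_ne_zero _ (L.weierstrassSigma_ne_zero hb)
  refine ⟨fun _ => M₀, ?_⟩
  rw [eval_bdryForm]
  refine Finset.prod_ne_zero_iff.mpr fun a _ => ?_
  simp only [thetaVec_apply, theta, thetaP_none, thetaPnone]
  refine mul_ne_zero ?_ (Finset.prod_ne_zero_iff.mpr fun b _ => hM b)
  rcases a with _ | j
  · simp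
  · simp [Complex.exp_ne_zero]

/-! ### The relations used by the reconstruction -/

/-- **Segre relations relative to a chart `M0`**: `X_{(a,I)}X_{(∅,(M0,∅))} - X_{(a,(M0,∅))}X_{(∅,I)}`.
[folklore] -/
def segreRel' (M0 : γ → Fin 3) (a : Option β) (I : ThetaIdx γ δ) : MvPolynomial (Option β × ThetaIdx γ δ) ℂ :=
  X (a, I) * X (none, (M0, none)) - X (a, (M0, (none : Option δ))) * X (none, I)

omit [Fintype β] [Fintype δ] in
/-- The Segre relations are relations. [folklore] -/
theorem segreRel'_mem_relSet (M0 : γ → Fin 3) (a : Option β) (I : ThetaIdx γ δ) :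
    segreRel' (β := β) M0 a I ∈ relSet L κM := by
  refine ⟨⟨2, ?_⟩, fun w => ?_⟩
  · unfold segreRel'
    have h1 : (X (a, I) * X (none, (M0, none)) : MvPolynomial (Option β × ThetaIdx γ δ) ℂ).IsHomogeneous 2 := by
      simpa using (isHomogeneous_X ℂ _).mul (isHomogeneous_X ℂ _)
    have h2 : (X (a, (M0, (none : Option δ))) * X (none, I) :
        MvPolynomial (Option β × ThetaIdx γ δ) ℂ).IsHomogeneous 2 := by
      simpa using (isHomogeneous_X ℂ _).mul (isHomogeneous_X ℂ _)
    exact h1.sub h2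
  · simp only [segreRel', thetaEval, map_sub, map_mul, eval_X, theta, thetaT_none, one_mul]
    ring

/-- **Block swap relations**: `X_{(Mx,∅)}X_{(M0,∅)} - X_{(Mx[b↦M0_b],∅)}X_{(M0[b↦Mx_b],∅)}`. [folklore] -/
def swapRel (Mx M0 : γ → Fin 3) (b : γ) : MvPolynomial (Option β × ThetaIdx γ δ) ℂ :=
  X ((none : Option β), (Mx, (none : Option δ))) * X ((none : Option β), (M0, (none : Option δ))) -
    X ((none : Option β), (Function.update Mx b (M0 b), (none : Option δ))) *
      X ((none : Option β), (Function.update M0 b (Mx b), (none : Option δ)))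

omit [Fintype β] [Fintype δ] in
/-- The block swap relations are relations. [folklore] -/
theorem swapRel_mem_relSet (Mx M0 : γ → Fin 3) (b : γ) : swapRel (β := β) (δ := δ) Mx M0 b ∈ relSet L κM := by
  refine ⟨⟨2, ?_⟩, fun w => ?_⟩
  · unfold swapRel
    have h1 : (X ((none : Option β), (Mx, (none : Option δ))) * X ((none : Option β), (M0, (none : Option δ))) :
        MvPolynomial (Option β × ThetaIdx γ δ) ℂ).IsHomogeneous 2 := by
      simpa using (isHomogeneous_X ℂ _).mul (isHomogeneous_X ℂ _)
    have h2 : (X ((none : Option β), (Function.update Mx b (M0 b), (none : Option δ))) *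
        X ((none : Option β), (Function.update M0 b (Mx b), (none : Option δ))) :
          MvPolynomial (Option β × ThetaIdx γ δ) ℂ).IsHomogeneous 2 := by
      simpa using (isHomogeneous_X ℂ _).mul (isHomogeneous_X ℂ _)
    exact h1.sub h2
  · simp only [swapRel, thetaEval, map_sub, map_mul, eval_X, theta_none_eq, thetaP_none, sub_eq_zero]
    unfold thetaPnone
    rw [← Finset.prod_mul_distrib, ← Finset.prod_mul_distrib]
    refine Finset.prod_congr rfl fun c _ => ?_
    by_cases hc : c = b
    · subst hc
      rw [Function.update_self, Function.update_self, mul_comm]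
    · rw [Function.update_of_ne hc, Function.update_of_ne hc]

/-- **The Weierstrass cubic in block `b` relative to the chart `M0`**:
`X₀X₂² - 4X₁³ + g₂X₀²X₁ + g₃X₀³` with `X_i = X_{(∅,(M0[b↦i],∅))}`. [folklore] -/
def cubicRel' (M0 : γ → Fin 3) (b : γ) : MvPolynomial (Option β × ThetaIdx γ δ) ℂ :=
  X ((none : Option β), (Function.update M0 b 0, (none : Option δ))) *
      X ((none : Option β), (Function.update M0 b 2, (none : Option δ))) ^ 2 -
    C 4 * X ((none : Option β), (Function.update M0 b 1, (none : Option δ))) ^ 3 +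
    C L.g₂ * X ((none : Option β), (Function.update M0 b 0, (none : Option δ))) ^ 2 *
      X ((none : Option β), (Function.update M0 b 1, (none : Option δ))) +
    C L.g₃ * X ((none : Option β), (Function.update M0 b 0, (none : Option δ))) ^ 3

omit [Fintype β] [Fintype δ] in
/-- The cubic relations are relations. [folklore] -/
theorem cubicRel'_mem_relSet (M0 : γ → Fin 3) (b : γ) : cubicRel' (β := β) (δ := δ) L M0 b ∈ relSet L κM := by
  refine ⟨⟨3, ?_⟩, fun w => ?_⟩
  · have h1 : (X ((none : Option β), (Function.update M0 b 0, (none : Option δ))) *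
        X ((none : Option β), (Function.update M0 b 2, (none : Option δ))) ^ 2 :
          MvPolynomial (Option β × ThetaIdx γ δ) ℂ).IsHomogeneous 3 := by
      simpa using (isHomogeneous_X ℂ _).mul ((isHomogeneous_X ℂ _).pow 2)
    have h2 : (C 4 * X ((none : Option β), (Function.update M0 b 1, (none : Option δ))) ^ 3 :
        MvPolynomial (Option β × ThetaIdx γ δ) ℂ).IsHomogeneous 3 := by
      simpa using ((isHomogeneous_X ℂ _).pow 3).C_mul 4
    have h3 : (C L.g₂ * X ((none : Option β), (Function.update M0 b 0, (none : Option δ))) ^ 2 *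
        X ((none : Option β), (Function.update M0 b 1, (none : Option δ))) :
          MvPolynomial (Option β × ThetaIdx γ δ) ℂ).IsHomogeneous 3 := by
      simpa [mul_assoc] using (((isHomogeneous_X ℂ _).pow 2).mul (isHomogeneous_X ℂ _)).C_mul L.g₂
    have h4 : (C L.g₃ * X ((none : Option β), (Function.update M0 b 0, (none : Option δ))) ^ 3 :
        MvPolynomial (Option β × ThetaIdx γ δ) ℂ).IsHomogeneous 3 := by
      simpa using ((isHomogeneous_X ℂ _).pow 3).C_mul L.g₃
    unfold cubicRel'
    exact ((h1.sub h2).add h3).add h4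
  · set E := ∏ c ∈ Finset.univ.erase b, L.univExtP (M0 c) (w (iz c)) with hE
    have hs : ∀ i : Fin 3, theta L κM ((none, (Function.update M0 b i, none)) : Option β × ThetaIdx γ δ) w =
        L.univExtP i (w (iz b)) * E := by
      intro i
      rw [theta_none_eq, thetaP_none]
      exact thetaPnone_update L M0 b i w
    simp only [cubicRel', thetaEval, map_add, map_sub, map_mul, map_pow, eval_X, eval_C, hs]
    have hc := L.univExtP_cubic (w (iz b))
    linear_combination E ^ 3 * hc

/-- **The exchange form of block `b`** between the block indices `Mx` and `M0`:
`Q_b = c₁₁ X₁X'₁ + c₂₂ X₂X'₂ + c₀₁ X₀X'₁ + c₀₀ X₀X'₀` (`X_k = X_{(Mx[b↦k],∅)}`, `X'_l = X_{(M0[b↦l],∅)}`,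
coefficients `exchangeCoeff (Mx b) (M0 b)`), with
`F_{Q_b} = (Z_{Mx_b}P_{M0_b} - Z_{M0_b}P_{Mx_b})(z'_b) ∏_{c≠b} P_{Mx_c}P_{M0_c}`. [folklore] -/
def exchangeForm (Mx M0 : γ → Fin 3) (b : γ) : MvPolynomial (Option β × ThetaIdx γ δ) ℂ :=
  C (L.exchangeCoeff (Mx b) (M0 b)).1 *
      (X ((none : Option β), (Function.update Mx b 1, (none : Option δ))) *
        X ((none : Option β), (Function.update M0 b 1, (none : Option δ)))) +
    C (L.exchangeCoeff (Mx b) (M0 b)).2.1 *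
      (X ((none : Option β), (Function.update Mx b 2, (none : Option δ))) *
        X ((none : Option β), (Function.update M0 b 2, (none : Option δ)))) +
    C (L.exchangeCoeff (Mx b) (M0 b)).2.2.1 *
      (X ((none : Option β), (Function.update Mx b 0, (none : Option δ))) *
        X ((none : Option β), (Function.update M0 b 1, (none : Option δ)))) +
    C (L.exchangeCoeff (Mx b) (M0 b)).2.2.2 *
      (X ((none : Option β), (Function.update Mx b 0, (none : Option δ))) *
        X ((none : Option β), (Function.update M0 b 0, (none : Option δ))))

omit [Fintype β] [Fintype γ] [Fintype δ] in
/-- The exchange form is quadratic. [folklore] -/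
theorem exchangeForm_isHomogeneous (Mx M0 : γ → Fin 3) (b : γ) :
    (exchangeForm (β := β) (δ := δ) L Mx M0 b).IsHomogeneous 2 := by
  have hXX : ∀ (A B : Option β × ThetaIdx γ δ) (c : ℂ),
      (C c * (X A * X B) : MvPolynomial (Option β × ThetaIdx γ δ) ℂ).IsHomogeneous 2 := by
    intro A B c
    simpa using ((isHomogeneous_X ℂ A).mul (isHomogeneous_X ℂ B)).C_mul c
  unfold exchangeForm
  exact (((hXX _ _ _).add (hXX _ _ _)).add (hXX _ _ _)).add (hXX _ _ _)

omit [Fintype β] [Fintype δ] in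
/-- The value of the exchange form. [folklore] -/
theorem thetaEval_exchangeForm (Mx M0 : γ → Fin 3) (b : γ) (w : β ⊕ (γ ⊕ δ) → ℂ) :
    thetaEval L κM (exchangeForm (β := β) (δ := δ) L Mx M0 b) w =
      (L.univExtZ (Mx b) (w (iz b)) * L.univExtP (M0 b) (w (iz b)) -
          L.univExtZ (M0 b) (w (iz b)) * L.univExtP (Mx b) (w (iz b))) *
        ((∏ c ∈ Finset.univ.erase b, L.univExtP (Mx c) (w (iz c))) *
          ∏ c ∈ Finset.univ.erase b, L.univExtP (M0 c) (w (iz c))) := by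
  have hs : ∀ (N : γ → Fin 3) (i : Fin 3),
      theta L κM ((none, (Function.update N b i, none)) : Option β × ThetaIdx γ δ) w =
        L.univExtP i (w (iz b)) * ∏ c ∈ Finset.univ.erase b, L.univExtP (N c) (w (iz c)) := by
    intro N i
    rw [theta_none_eq, thetaP_none]
    exact thetaPnone_update L N b i w
  rw [L.exchange_identity]
  simp only [exchangeForm, thetaEval, map_add, map_mul, eval_X, eval_C, hs]
  ring

/-- **The exchange relations of the fibre coordinates** between `Mx` and the chart `M0`:
`X_{(Mx,e)}X_{(M0,∅)} - X_{(M0,e)}X_{(Mx,∅)} + ∑_b κ_{eb} Q_b`. [folklore] -/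
def exchangeRel (Mx M0 : γ → Fin 3) (e : δ) : MvPolynomial (Option β × ThetaIdx γ δ) ℂ :=
  X ((none : Option β), (Mx, some e)) * X ((none : Option β), (M0, (none : Option δ))) -
      X ((none : Option β), (M0, some e)) * X ((none : Option β), (Mx, (none : Option δ))) +
    ∑ b, C (κM e b : ℂ) * exchangeForm L Mx M0 b

omit [Fintype β] [Fintype δ] in
/-- **The exchange relations are relations** (the `s_e`-terms cancel; the `ζ`-terms are the
exchange forms). [folklore] -/
theorem exchangeRel_mem_relSet (Mx M0 : γ → Fin 3) (e : δ) :
    exchangeRel (β := β) L κM Mx M0 e ∈ relSet L κM := by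
  refine ⟨⟨2, ?_⟩, fun w => ?_⟩
  · have hXX' : ∀ A B : Option β × ThetaIdx γ δ,
        (X A * X B : MvPolynomial (Option β × ThetaIdx γ δ) ℂ).IsHomogeneous 2 := by
      intro A B
      simpa using (isHomogeneous_X ℂ A).mul (isHomogeneous_X ℂ B)
    unfold exchangeRel
    refine ((hXX' _ _).sub (hXX' _ _)).add (IsHomogeneous.sum _ _ _ fun b _ => ?_)
    simpa using (exchangeForm_isHomogeneous L Mx M0 b).C_mul (κM e b : ℂ)
  · have hev : thetaEval L κM (exchangeRel (β := β) L κM Mx M0 e) w =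
        thetaPsome (β := β) L κM Mx e w * thetaPnone (β := β) (δ := δ) L M0 w -
            thetaPsome (β := β) L κM M0 e w * thetaPnone (β := β) (δ := δ) L Mx w +
          ∑ b, (κM e b : ℂ) * thetaEval L κM (exchangeForm (β := β) (δ := δ) L Mx M0 b) w := by
      simp only [exchangeRel, thetaEval, map_add, map_sub, map_mul, map_sum, eval_X, eval_C, theta_none_eq,
        thetaP_none, thetaP_some]
    rw [hev]
    simp only [thetaEval_exchangeForm]
    -- the `s`-terms cancel
    have hA : thetaPsome (β := β) L κM Mx e w * thetaPnone (β := β) (δ := δ) L M0 w -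
        thetaPsome (β := β) L κM M0 e w * thetaPnone (β := β) (δ := δ) L Mx w =
        (∑ b, (κM e b : ℂ) * (L.univExtZ (M0 b) (w (iz b)) *
            ∏ b' ∈ Finset.univ.erase b, L.univExtP (M0 b') (w (iz b')))) * thetaPnone (β := β) (δ := δ) L Mx w -
          (∑ b, (κM e b : ℂ) * (L.univExtZ (Mx b) (w (iz b)) *
            ∏ b' ∈ Finset.univ.erase b, L.univExtP (Mx b') (w (iz b')))) * thetaPnone (β := β) (δ := δ) L M0 w := by
      unfold thetaPsome
      ring
    rw [hA, Finset.sum_mul, Finset.sum_mul, ← Finset.sum_sub_distrib, ← Finset.sum_add_distrib]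
    refine Finset.sum_eq_zero fun b _ => ?_
    rw [thetaPnone_eq_mul_prod_erase L Mx w b, thetaPnone_eq_mul_prod_erase L M0 w b]
    ring

/-! ### The image theorem -/

omit [Fintype δ] in
/-- **The image theorem (field `surj` of `AnalyticGroupModel`)**: a point `x ∈ ℂ^{N+1}` killing all
homogeneous relations of `Θ` at which some boundary form is non-zero is a point `c · Θ(w)` of the
cone over `Θ(Lie M_κ,ℂ)`. [cite: NesterenkoPhilippon2001, Ch. 11 §2.1, §2.3] -/
theorem theta_surj (x : Option β × ThetaIdx γ δ → ℂ) (hrel : ∀ P ∈ relSet L κM, eval x P = 0)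
    (hb : ∃ M : Option β → (γ → Fin 3), eval x (bdryForm (δ := δ) M) ≠ 0) :
    ∃ (c : ℂ) (w : β ⊕ (γ ⊕ δ) → ℂ), x = c • thetaVec L κM w := by
  classical
  obtain ⟨Mb, hMb⟩ := hb
  rw [eval_bdryForm] at hMb
  have hxa : ∀ a, x (a, (Mb a, none)) ≠ 0 := fun a h =>
    hMb (Finset.prod_eq_zero (Finset.mem_univ a) h)
  -- the chart `M0` of the `P_κ`-part and the base coordinate `x₀ ≠ 0`
  set M0 : γ → Fin 3 := Mb none with hM0
  set x₀ : ℂ := x (none, (M0, none)) with hx₀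
  have hx₀ne : x₀ ≠ 0 := hxa none
  -- (1) Segre: `x_{(a,I)} x₀ = t_a p_I`
  have hSegre : ∀ (a : Option β) (I : ThetaIdx γ δ),
      x (a, I) * x₀ = x (a, (M0, none)) * x (none, I) := by
    intro a I
    have h := hrel _ (segreRel'_mem_relSet L κM M0 a I)
    simp only [segreRel', map_sub, map_mul, eval_X] at h
    linear_combination h
  have hta : ∀ a, x (a, (M0, none)) ≠ 0 := by
    intro a hta
    apply hxa a
    have h := hSegre a (Mb a, none)
    rw [hta, zero_mul, mul_eq_zero] at h
    exact h.resolve_right hx₀ne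
  -- (2) the block vectors `q_b(i) = p_{(M0[b↦i], ∅)}` are on the cubic cone: `q_b = c_b P(z_b)`
  have hblock : ∀ b, ∃ (z c : ℂ), c ≠ 0 ∧ ∀ i : Fin 3,
      x (none, (Function.update M0 b i, none)) = c * L.univExtP i z := by
    intro b
    refine exists_univExtP_eq_smul L (fun i => x (none, (Function.update M0 b i, none))) ?_ ?_
    · intro h
      have := congr_fun h (M0 b)
      simp only [Function.update_eq_self, Pi.zero_apply] at this
      exact hx₀ne this
    · have h := hrel _ (cubicRel'_mem_relSet (β := β) (δ := δ) L κM M0 b)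
      simp only [cubicRel', map_add, map_sub, map_mul, map_pow, eval_X, eval_C] at h
      linear_combination h
  choose z c hc hq using hblock
  -- the base coordinate on each block
  have hx₀b : ∀ b, x₀ = c b * L.univExtP (M0 b) (z b) := fun b => by
    have := hq b (M0 b)
    rwa [Function.update_eq_self] at this
  have hPb : ∀ b, L.univExtP (M0 b) (z b) ≠ 0 := fun b h =>
    hx₀ne (by rw [hx₀b b, h, mul_zero])
  -- (3) the block part is rank one: `p_{(Mx,∅)} = C · ∏_b P_{Mx_b}(z_b)`
  set Pi0 : ℂ := ∏ b, L.univExtP (M0 b) (z b) with hPi0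
  have hPi0ne : Pi0 ≠ 0 := Finset.prod_ne_zero_iff.mpr fun b _ => hPb b
  set C₀ : ℂ := x₀ / Pi0 with hC₀
  have hC₀ne : C₀ ≠ 0 := div_ne_zero hx₀ne hPi0ne
  have hrank : ∀ (n : ℕ) (Mx : γ → Fin 3), (Finset.univ.filter fun b => Mx b ≠ M0 b).card ≤ n →
      x (none, (Mx, none)) = C₀ * ∏ b, L.univExtP (Mx b) (z b) := by
    intro n
    induction n with
    | zero =>
      intro Mx hMx
      have hM : Mx = M0 := by
        funext b
        by_contra h
        have : b ∈ Finset.univ.filter fun b => Mx b ≠ M0 b := Finset.mem_filter.mpr ⟨Finset.mem_univ _, h⟩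
        rw [Nat.le_zero, Finset.card_eq_zero] at hMx
        rw [hMx] at this
        simp at this
      rw [hM, ← hx₀, ← hPi0, hC₀]
      field_simp
    | succ n ih =>
      intro Mx hMx
      by_cases hle : (Finset.univ.filter fun b => Mx b ≠ M0 b).card ≤ n
      · exact ih Mx hle
      · -- pick a block where `Mx` differs from `M0` and swap it
        have hne : (Finset.univ.filter fun b => Mx b ≠ M0 b).Nonempty := by
          rw [← Finset.card_pos]; omega
        obtain ⟨b, hbm⟩ := hne
        have hb : Mx b ≠ M0 b := (Finset.mem_filter.mp hbm).2
        set Mx' := Function.update Mx b (M0 b) with hMx'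
        have hcard : (Finset.univ.filter fun b' => Mx' b' ≠ M0 b').card ≤ n := by
          have hsub : (Finset.univ.filter fun b' => Mx' b' ≠ M0 b') ⊆
              (Finset.univ.filter fun b' => Mx b' ≠ M0 b').erase b := by
            intro b' hb'
            rw [Finset.mem_filter] at hb'
            rw [Finset.mem_erase, Finset.mem_filter]
            have hb'b : b' ≠ b := fun h => by
              rw [h, hMx', Function.update_self] at hb'
              exact hb'.2 rfl
            refine ⟨hb'b, Finset.mem_univ _, ?_⟩
            have := hb'.2
            rwa [hMx', Function.update_of_ne hb'b] at this
          have := Finset.card_le_card hsub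
          rw [Finset.card_erase_of_mem hbm] at this
          omega
        have hIH := ih Mx' hcard
        -- the swap relation: `p_{Mx} x₀ = p_{Mx'} q_b(Mx b)`
        have hswap := hrel _ (swapRel_mem_relSet (β := β) (δ := δ) L κM Mx M0 b)
        simp only [swapRel, map_sub, map_mul, eval_X] at hswap
        rw [← hx₀, sub_eq_zero, ← hMx', hIH, hq b (Mx b)] at hswap
        -- solve for `p_{Mx}`
        set E := ∏ b' ∈ Finset.univ.erase b, L.univExtP (Mx b') (z b') with hE
        have hE1 : ∏ b', L.univExtP (Mx' b') (z b') = L.univExtP (M0 b) (z b) * E := by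
          rw [← Finset.mul_prod_erase _ _ (Finset.mem_univ b), hMx', Function.update_self]
          congr 1
          exact Finset.prod_congr rfl fun b' hb' => by rw [Function.update_of_ne (Finset.ne_of_mem_erase hb')]
        have hE2 : ∏ b', L.univExtP (Mx b') (z b') = L.univExtP (Mx b) (z b) * E :=
          (Finset.mul_prod_erase _ _ (Finset.mem_univ b)).symm
        have hgoal : x (none, (Mx, none)) * x₀ = (C₀ * ∏ b', L.univExtP (Mx b') (z b')) * x₀ := by
          rw [hswap, hE1, hE2, hx₀b b]
          ring
        exact mul_right_cancel₀ hx₀ne hgoal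
  have hp : ∀ Mx : γ → Fin 3, x (none, (Mx, none)) = C₀ * ∏ b, L.univExtP (Mx b) (z b) :=
    fun Mx => hrank _ Mx le_rfl
  -- (4) the torus part by logarithms
  set y : β → ℂ := fun j => Complex.log (x (some j, (M0, none)) / x₀) with hy
  -- (5) the fibre coordinates from the chart ratios
  set Zsum : δ → ℂ := fun e => ∑ b, (κM e b : ℂ) * (L.univExtZ (M0 b) (z b) *
    ∏ b' ∈ Finset.univ.erase b, L.univExtP (M0 b') (z b')) with hZsum
  set sc : δ → ℂ := fun e => (x (none, (M0, some e)) / C₀ + Zsum e) / Pi0 with hsc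
  -- the point
  let w : β ⊕ (γ ⊕ δ) → ℂ := fun k => Sum.elim y (Sum.elim z sc) k
  have hwy : ∀ j, w (iy j) = y j := fun j => by simp [w, iy]
  have hwz : ∀ b, w (iz b) = z b := fun b => by simp [w, iz]
  have hws : ∀ e, w (is e) = sc e := fun e => by simp [w, is]
  have hPnone : ∀ Mx : γ → Fin 3, thetaPnone (β := β) (δ := δ) L Mx w = ∏ b, L.univExtP (Mx b) (z b) := by
    intro Mx
    unfold thetaPnone
    exact Finset.prod_congr rfl fun b _ => by rw [hwz]
  have hPi0w : thetaPnone (β := β) (δ := δ) L M0 w = Pi0 := hPnone M0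
  have hx₀eq : x₀ = C₀ * Pi0 := by rw [hC₀]; field_simp
  -- torus coordinates
  have hT : ∀ a : Option β, x (a, (M0, none)) = thetaT (γ := γ) (δ := δ) a w * x₀ := by
    rintro (_ | j)
    · rw [thetaT_none, one_mul]
    · rw [thetaT_some, hwy]
      simp only [hy]
      rw [Complex.exp_log (div_ne_zero (hta (some j)) hx₀ne)]
      field_simp
  -- the chart fibre coordinate
  have hPsome0 : ∀ e, C₀ * thetaPsome (β := β) L κM M0 e w = x (none, (M0, some e)) := by
    intro e
    have h1 : thetaPsome (β := β) L κM M0 e w = sc e * Pi0 - Zsum e := by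
      unfold thetaPsome
      rw [hws, hPi0w]
      simp only [hZsum, hwz]
    rw [h1]
    simp only [hsc]
    field_simp
    ring
  -- (6) all the fibre coordinates, by the exchange relations
  have hPsome : ∀ (Mx : γ → Fin 3) (e : δ),
      x (none, (Mx, some e)) = C₀ * thetaPsome (β := β) L κM Mx e w := by
    intro Mx e
    -- the relation at `x` and at `Θ(w)`
    have hxrel := hrel _ (exchangeRel_mem_relSet (β := β) L κM Mx M0 e)
    have hwrel := (exchangeRel_mem_relSet (β := β) L κM Mx M0 e).2 w
    -- the exchange forms at `x` are `C₀²` times their values at `w`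
    have hQ : ∀ b, eval x (exchangeForm (β := β) (δ := δ) L Mx M0 b) =
        C₀ ^ 2 * thetaEval L κM (exchangeForm (β := β) (δ := δ) L Mx M0 b) w := by
      intro b
      simp only [exchangeForm, thetaEval, map_add, map_mul, eval_X, eval_C, hp, theta_none_eq, thetaP_none, hPnone]
      ring
    have hxrel' : x (none, (Mx, some e)) * x₀ - x (none, (M0, some e)) * x (none, (Mx, none)) +
        ∑ b, (κM e b : ℂ) * (C₀ ^ 2 * thetaEval L κM (exchangeForm (β := β) (δ := δ) L Mx M0 b) w) = 0 := by
      simp only [exchangeRel, map_add, map_sub, map_mul, map_sum, eval_X, eval_C, hQ] at hxrel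
      rw [← hx₀] at hxrel
      exact hxrel
    have hwrel' : thetaPsome (β := β) L κM Mx e w * Pi0 - thetaPsome (β := β) L κM M0 e w * thetaPnone (β := β) (δ := δ) L Mx w +
        ∑ b, (κM e b : ℂ) * thetaEval L κM (exchangeForm (β := β) (δ := δ) L Mx M0 b) w = 0 := by
      simp only [exchangeRel, thetaEval, map_add, map_sub, map_mul, map_sum, eval_X, eval_C, theta_none_eq,
        thetaP_none, thetaP_some] at hwrel
      rw [hPi0w] at hwrel
      exact hwrel
    have hsum : ∑ b, (κM e b : ℂ) * (C₀ ^ 2 * thetaEval L κM (exchangeForm (β := β) (δ := δ) L Mx M0 b) w) =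
        C₀ ^ 2 * ∑ b, (κM e b : ℂ) * thetaEval L κM (exchangeForm (β := β) (δ := δ) L Mx M0 b) w := by
      rw [Finset.mul_sum]
      exact Finset.sum_congr rfl fun b _ => by ring
    rw [hsum, ← hPsome0 e, hp Mx, ← hPnone Mx, hx₀eq] at hxrel'
    have hkey : (x (none, (Mx, some e)) - C₀ * thetaPsome (β := β) L κM Mx e w) * (C₀ * Pi0) = 0 := by
      linear_combination hxrel' - C₀ ^ 2 * hwrel'
    rcases mul_eq_zero.mp hkey with h | h
    · exact sub_eq_zero.mp h
    · exact absurd h (mul_ne_zero hC₀ne hPi0ne)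
  -- (7) conclusion
  refine ⟨C₀, w, funext fun J => ?_⟩
  obtain ⟨a, Mx, o⟩ := J
  have hS := hSegre a (Mx, o)
  rw [hT a] at hS
  have hx : x (a, (Mx, o)) = thetaT (γ := γ) (δ := δ) a w * x (none, (Mx, o)) := by
    have : (x (a, (Mx, o)) - thetaT (γ := γ) (δ := δ) a w * x (none, (Mx, o))) * x₀ = 0 := by
      linear_combination hS
    exact sub_eq_zero.mp ((mul_eq_zero.mp this).resolve_right hx₀ne)
  rw [hx]
  simp only [Pi.smul_apply, smul_eq_mul, thetaVec_apply, theta]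
  rcases o with _ | e
  · rw [thetaP_none, hp Mx, ← hPnone Mx]
    ring
  · rw [thetaP_some, hPsome Mx e]
    ring

omit [Fintype δ] in
/-- **The image theorem in the shape of the field `surj`** (hypotheses: `x` kills every form
vanishing on `Θ(V)`, and some boundary form is non-zero at `x`). [cite: NesterenkoPhilippon2001, Ch. 11 §2.1] -/
theorem theta_surj' (x : Option β × ThetaIdx γ δ → ℂ)
    (hrel : ∀ (P : MvPolynomial (Option β × ThetaIdx γ δ) ℂ) (d : ℕ), P.IsHomogeneous d →
      (∀ w, thetaEval L κM P w = 0) → eval x P = 0)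
    (hb : ∃ M : Option β → (γ → Fin 3), eval x (bdryForm (δ := δ) M) ≠ 0) :
    ∃ (c : ℂ) (w : β ⊕ (γ ⊕ δ) → ℂ), x = c • thetaVec L κM w :=
  theta_surj L κM x (fun P hP => by obtain ⟨⟨d, hd⟩, h0⟩ := hP; exact hrel P d hd h0) hb

end Std

end GaGmE


end Literature.NumberTheory.Transcendental

end
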